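import Mathlib
import HarnessLib
import HarnessLib.Audit
import Summits.AtomisticToContinuum.Statement
import Literature.Analysis.FluidPDE.HardSphereCollisionRecord
import HarnessLib.Audit.Status.Attr

/-!
Route: DimensionLadder

DORMANT since 2026-08-22T19:33:06Z (reconciler: no traction for 5.6 d (last activity item-evidence-added at 2026-08-17T04:27:27Z); parked, not closed — `ledger route dormant route-AtomisticToContinuum-DimensionLadder --off` to reactivat) — unstaffed, not closed; items shared with open routes are served there. `ledger route dormant <id> --off` reactivates.

# Route DimensionLadder — Let the dimension do the mixing — one d-uniform local-equilibrium engine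
for the packing-guarded fixed-density Euler limit on T^d, proved from the top rung d ≥ d₀ down to d
= 3

It suffices to show X = AllDimensionEuler (card large-dimension-ladder, spine; re-filed with the
D-0027 §2.1 deciding theorem closes after the
2026-08-15 purge retired the identical route-AtomisticToContinuum-LargeDimensionLadder opened two
hours earlier): for EVERY dimension d ≥ 3 the packing-guarded
fixed-density Euler limit holds on 𝕋^d — N+1 deterministic hard spheres of diameter σ(N+1)^(-1/d),
(N+1)ε^d = σ^d fixed (no Boltzmann–Grad),
local Gibbs data, classical d-dimensional hard-sphere Euler solution (E = ρ(|u|²/2 + dθ/2), p =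
ρθZ_d(ρσ^d)) with local packing ρ_tσ^d < η₀(d),
LLN of the fields at t = 0 ⇒ LLN at every t < T. Its d = 3 member IS the sub-problem Statement:
since the statement re-type of 2026-08-16 (p126922, retype
hydro2, D-0032) `HydrodynamicLimit` is the PACKING-GUARDED d = 3 conjunct (= HydroLimitInBandDim 3,
hydroLimitInBandDim_three_iff_root;
historically HydroLimitInBand, stmt 3093), so X → Statement is pure unfolding and
DiluteSelfConsistency (stmt 3091) has left the path. The LINE is a ladder in the hidden parameter d
at
fixed reduced density η = ρσ^d: prove X first on the top rungs d ≥ d₀ (crux HighDimensionEuler),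
where high-dimensional geometry supplies
three suppressions at once — strangers (non-local recollisions per collision ≍ K_d^-(d-1), K_d = ℓ/ε
= 1/(V_(d-1)η) superexponentially large),
gentle kicks (mean-square deflection ≤ π²/d, support GrazingDeflectionMoment: the tagged velocity is
an Ornstein–Uhlenbeck-like sum of many
small fresh kicks, the structure behind the physicists' exact d = ∞ liquid dynamics), short memory
(tails t^(-d/2), ring logarithms only at
order η^(d-1)) — by ONE d-uniform engine, LocalEquilibriumAllDim (1-marginal → local Maxwellian of
the Euler solution, 2-marginal
factorises, RELATIVE to the local hard-sphere Gibbs state), whose constants are explicit in (d, η)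
and are then followed down to d = 3, where
smallness comes from η alone (the conjunct's own σ < σ₀). Honest caveat (audit design point 1): at
fixed η the top rung is dilute in the
kinetic sense (ε/ℓ = V_(d-1)η → 0 superexponentially, Z − 1 ≍ V_dη/2), so the descent d → 3 IS the
dilute → dense step relabelled; what the
d-axis adds over the σ-axis is the grazing/CLT structure and the weaker memory, not a new density
regime.
Lean: `∀ d : ℕ, 3 ≤ d → ∃ η₀ : ℝ, 0 < η₀ ∧ ∀ (a₀ θ₀ : UnitAddTorus (Fin d) → ℝ) (u₀ : UnitAddTorus
(Fin d) → EuclideanSpace ℝ (Fin d)), Continuous a₀ → Continuous θ₀ → Continuous u₀ → (∀ x, 0 < a₀ x)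
→ (∀ x, 0 < θ₀ x) → ∃ σ₀ : ℝ, 0 < σ₀ ∧ ∀ σ : ℝ, 0 < σ → σ < σ₀ → let G :=
Literature.Analysis.FluidPDE.Torus.geometry (Fin d); let ε := fun N : ℕ => σ * ((N + 1 : ℕ) : ℝ) ^
(-(1 / (d : ℝ))); let f₀ := fun y : UnitAddTorus (Fin d) × EuclideanSpace ℝ (Fin d) => a₀ y.1 *
Literature.Analysis.FluidPDE.localMaxwellian 1 (θ₀ y.1) (u₀ y.1) y.2; ∀ (T : ℝ) (ρ θ : ℝ →
UnitAddTorus (Fin d) → ℝ) (u : ℝ → UnitAddTorus (Fin d) → EuclideanSpace ℝ (Fin d)), let Z := fun η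
: ℝ => 1 + η * deriv (fun η' : ℝ => limsup (fun n : ℕ => -(n : ℝ)⁻¹ * Real.log (volume {q : Fin n →
UnitAddTorus (Fin d) | ∀ i j, i ≠ j → (η' / n) ^ (1 / (d : ℝ)) <
Literature.Analysis.FluidPDE.Torus.euclidDist (q i) (q j)}).toReal) atTop) η; let P := fun r ϑ : ℝ
=> r * ϑ * Z (r * σ ^ d); let E := fun (r : ℝ) (w : EuclideanSpace ℝ (Fin d)) (ϑ : ℝ) => r * (‖w‖ ^
2 / 2 + (d : ℝ) / 2 * ϑ); Literature.Analysis.FunctionSpaces.Torus.IsSmoothSpaceTimeOn (Ico 0 T) ρ →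
Literature.Analysis.FunctionSpaces.Torus.IsSmoothSpaceTimeOn (Ico 0 T) u →
Literature.Analysis.FunctionSpaces.Torus.IsSmoothSpaceTimeOn (Ico 0 T) θ → (∀ t ∈ Ico 0 T, ∀ x, 0 <
ρ t x) → (∀ t ∈ Ico 0 T, ∀ x, 0 < θ t x) → (∀ t ∈ Ico 0 T, ∀ x,
Literature.Analysis.FunctionSpaces.Torus.timeDerivWithin (Ico 0 T) ρ t x +
Literature.Analysis.FunctionSpaces.Torus.divergence (fun y => ρ t y • u t y) x = 0) → (∀ t ∈ Ico 0
T, ∀ x, Literature.Analysis.FunctionSpaces.Torus.timeDerivWithin (Ico 0 T) (fun s y => ρ s y • u s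
y) t x + (∑ i, Literature.Analysis.FunctionSpaces.Torus.partialDeriv i (fun y => (ρ t y * u t y i) •
u t y) x) + Literature.Analysis.FunctionSpaces.Torus.gradient (fun y => P (ρ t y) (θ t y)) x = 0) →
(∀ t ∈ Ico 0 T, ∀ x, Literature.Analysis.FunctionSpaces.Torus.timeDerivWithin (Ico 0 T) (fun s y =>
E (ρ s y) (u s y) (θ s y)) t x + Literature.Analysis.FunctionSpaces.Torus.divergence (fun y => (E (ρ
t y) (u t y) (θ t y) + P (ρ t y) (θ t y)) • u t y) x = 0) → (∀ t ∈ Ico 0 T, ∀ x, ρ t x * σ ^ d < η₀)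
→ ∀ Φ : (N : ℕ) → Literature.Analysis.FluidPDE.HardSphereFlow G (ε N) (N + 1), let L := fun N : ℕ =>
Literature.Analysis.FluidPDE.particleLaw (Φ N) (Literature.Analysis.FluidPDE.canonicalDensity G (ε
N) (N + 1) f₀); let Tend := fun t : ℝ => ∀ χ : UnitAddTorus (Fin d) → ℝ, Continuous χ → ∀ δ > (0 :
ℝ), Tendsto (fun N => L N {z | δ < |(∫ y, χ y.1 ∂Literature.Analysis.FluidPDE.empiricalMeasure ((Φ
N).flow t z)) - ∫ x, χ x * ρ t x|}) atTop (nhds 0) ∧ Tendsto (fun N => L N {z | δ < ‖(∫ y, χ y.1 •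
y.2 ∂Literature.Analysis.FluidPDE.empiricalMeasure ((Φ N).flow t z)) - ∫ x, (χ x * ρ t x) • u t x‖})
atTop (nhds 0) ∧ Tendsto (fun N => L N {z | δ < |(∫ y, χ y.1 * (‖y.2‖ ^ 2 / 2)
∂Literature.Analysis.FluidPDE.empiricalMeasure ((Φ N).flow t z)) - ∫ x, χ x * E (ρ t x) (u t x) (θ t
x)|}) atTop (nhds 0); Tend 0 → ∀ t ∈ Ico 0 T, Tend t`

## Assembly
DECIDING THEOREM (D-0027 §2.1; re-cut 2026-08-16T23:13Z, rev 18, route-repair after the statement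
re-type p126922):
theorem closes (hX : AllDimensionEuler) : HydrodynamicLimit — take X at d = 3, pass its η₀ and σ₀
through, feed the Statement's own
packing guard where the rev-11 proof fed DiluteSelfConsistency; pure unfolding
(IsHardSphereEulerSolution fields + defeq of hsDiameter /
localGibbsLaw / TendstoHydroFieldsAt / hsPressure with the inlined d-generic form); sorry-free,
axioms propext, Classical.choice, Quot.sound,
native OK. X → Statement is literally `closes`; Cruxes → X is the support item EngineToAllDim
(stmt-AtomisticToContinuum-14524, rank 10):
LocalEquilibriumAllDim → FlowRelabelSymmetry → MarginalsToFieldsAllDim → AllDimensionEuler —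
bookkeeping + slice continuity of smooth
space–time fields (IsSmoothSpaceTimeOn.isSmooth_slice / IsSmooth.continuous), provable now
(engineToAllDim_holds in the planner's Sketch.lean,
rc 0). The item Assembly (9349) is EngineToAllDim composed with `closes`: LocalEquilibriumAllDim →
FlowRelabelSymmetry →
MarginalsToFieldsAllDim → HydrodynamicLimit (restated 2026-08-16 from the rev-4 five-hypothesis
form, whose tail DimThreeGlue →
DiluteSelfConsistency → unguarded HydrodynamicLimit targeted the pre-retype abbrev).
DiluteSelfConsistency (stmt 3091) is detached from this
route: the guard it used to supply is now a hypothesis of the conjunct (it stays a shared item of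
the routes that still want the unguarded
limit, reachable from the conjunct by HydrodynamicLimit.of_unguarded in the other direction only).
Only the d = 3 members are consumed
formally — the ∀ d form of the engine and the rung HighDimensionEuler encode the proof STRATEGY (top
rung first, explicit constants, descent),
not extra logical strength; this is stated, not hidden.

Rationale: WHY THIS LINE. Mechanism: in dimension d at fixed η every collision partner is a stranger and every
collision is a whisper — the Stosszahlansatz relative to
local equilibrium becomes a law of large numbers over many small, conditionally fresh kicks, and the
creation rate of dynamical correlations
(recollisions, ≍ K_d^-(d-1) per collision for long loops, ≍ 1/K_d for local three-body encounters)
is superexponentially smaller in d than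
their destruction rate (≍ 1/d per collision, momentum relaxation in ≍ d grazing collisions):
Cohen1967 §2 (dimension count of ring phase space;
van Leeuwen–Weijland l = s rule recorded in
Literature.Barriers.AtomisticToContinuum.NoDensityExpansionBarrier), ElskensFrisch1988 (kinetic
theory of hard spheres as d → ∞), MaimbourgKurchanZamponi2016 and AgoritsasMaimbourgZamponi2019
(exact d = ∞ liquid dynamics = O(d) weak kicks
from distinct neighbours; non-rigorous DMFT), WylerRivierFrisch1987 / FrischPercus1999 (statics:
virial series superexponentially convergent at
fixed η), BoblylevPulvirentiSaffirio2012 (particles → Landau consistency in the grazing regime —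
here the grazing law is supplied by
concentration of measure, not by scaling the potential). Imported areas: high-dimensional convex
geometry / concentration of measure (rim law of
the impact parameter, cap measures) and the physics of d = ∞ liquids, pointed at the rigorous
kinetic programme (Lanford1975, GST2013,
BGSSAnnals2023, PulvirentiSimonella2016, DengHaniMa2024). What it does that the board does not:
DenseKineticExpansion attacks the d = 3 cumulant
expansion (0804) head-on with no small parameter beyond σ; this route supplies a continuous axis on
which the same engine has a superexponentially
small parameter and a theorem-shaped top rung (HighDimensionEuler), typed d-generically so that its
d = 3 member is literally the guarded conjunct;
the retired companion hilbert-six-in-log-dimensions (fixed SECOND-VIRIAL density, refuted: ℓ/ε → 0,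
squeeze recollisions polynomial) is
avoided because here ℓ/ε = K_d → ∞. Negatives index empty at filing.

RANKED CRUXES. #0 AllDimensionEuler (target) — X: for every d ≥ 3 there is η₀(d) > 0 such that for
all continuous positive profiles on 𝕋^d there is σ₀ with: for σ < σ₀, every classical d-dimensional
hard-sphere Euler solution on [0,T) with packing ρ_tσ^d < η₀ and every family of hard-sphere flows,
LLN of the empirical density/momentum/energy fields under the local Gibbs law at t = 0 implies LLN
at every t < T (d-generic packing-guarded conjunct, inlined; d = 3 member = the conjunct
HydrodynamicLimit = HydroLimitInBandDim 3, by unfolding). Follows from LocalEquilibriumAllDim +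
FlowRelabelSymmetry + MarginalsToFieldsAllDim by the support item EngineToAllDim (stmt-14524, rank
10, provable now) and IS the deciding theorem's only hypothesis since rev 18 (closes :
AllDimensionEuler → HydrodynamicLimit, the re-typed packing-guarded conjunct of p126922 being
verbatim its d = 3 member). (why it might fail: Contains the guarded d = 3 conjunct; and
d-uniformity may fail the other way: for d = 3,4 the engine's constant C_d(η₀) < 1 may force η₀(d)
far below any physically dilute density, i.e. the ladder may not reach the ground.) [Spohn1991,
OllaVaradhanYau1993, Cohen1967, ElskensFrisch1988]
#2 HighDimensionEuler (crux) — TOP RUNG (card R2): there is d₀ such that for every d ≥ d₀ the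
packing-guarded fixed-density Euler limit holds on 𝕋^d (same inlined statement as the target, ∃ d₀ ∀
d ≥ d₀). The rung where all three suppressions (strangers K_d^-(d-1), gentle kicks π²/d, memory
t^(-d/2)) are available; the informative first theorem of the ladder and the calibration point for
the d = 3 engine (DenseKineticExpansion 0804). [difficulty: open-problem] (why it might fail: Even
at d ≫ 1 each sphere makes ≍ N^(1/d)·V_(d-1)η√d/σ → ∞ collisions per unit time: decorrelation over
unbounded collision sequences is unproved in ANY d (Lanford radius ≈ 0.2 mft is combinatorial,
d-independent); MKZ's d = ∞ dynamics is physics-level and dense (φ̂ = O(1)).) [Lanford1975, GST2013,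
BGSSAnnals2023, MaimbourgKurchanZamponi2016, AgoritsasMaimbourgZamponi2019, ElskensFrisch1988,
Spohn1991]
#3 LocalEquilibriumAllDim (crux) — THE d-UNIFORM ENGINE (card D2 DressedContraction, typed shadow; d
= 3 member = packing-guarded form of DenseKineticExpansion's FixedFractionCumulantExpansion 0804):
for every d ≥ 3 there is η₀(d) > 0 such that for all profiles ∃ σ₀ ∀ σ < σ₀, every guarded classical
d-dim hs-Euler solution, every flow family with LLN at t = 0, and every t < T: the 1-particle
marginal of the time-t density W_N(t) = 1_D · (canonical local Gibbs density ∘ Φ_(-t)) converges in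
(1+|v|²)²-weighted L¹ to ρ_t(x)M_(1,u_t(x),θ_t(x))(v) and the 2-particle marginal minus the product
of 1-marginals tends to 0 in (1+|v|²)(1+|v′|²)-weighted L¹. Intended proof: cumulants relative to
the local hard-sphere Gibbs state, propagated by collision-dressed (mean-free-path damped)
propagators, contract uniformly on Euler times because creation (rate r_d·ν) loses to destruction
(rate ν/d); constants explicit in (d, η), superexponentially good in d, (πη)²-type at d = 3.
[difficulty: open-problem] (why it might fail: At d = 3 it is the fixed-density Boltzmann property
relative to local Gibbs over ≍N^(1/3) collision times (Spohn1991 I.3: no proof); hydrodynamic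
(conserved-mode) pair correlations are not damped by collisions and ring resummation completeness is
unproved (Cohen1967 §4c-d) — uniformly in d.) [Cohen1967, Spohn1991, PulvirentiSimonella2016,
BGSSAnnals2023, DengHaniMa2024, arXiv:2503.01800, ElskensFrisch1988]
#4 FreshPartnerStatisticsR (crux) — FRESH PARTNERS AND GENTLE KICKS, repaired and typed (card D1;
replaces the informal stmt-9750 refuted-MISSTATED by crux-attack rattack-9750-0, 2026-08-16): at
EQUILIBRIUM on 𝕋^d, η = σ^d < η₀(d), ℓ = ε/(V_(d−1)η), τ = ℓ/⟨|v−v*|⟩, window of s ≥ 1 mean free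
times: ∃ absolute C, d₀ ≥ 4 such that for d ≥ d₀, η < η₀(d), all s, n and N ≥ N₀(d,η,σ,s,n): (a′)
distant recollisions (re-hit within sτ after minimal-image separation ≥ ℓ) have probability ≤
C^d·s·(V_(d−1)η)^(d−1); (b′) local recollisions (separation < ℓ throughout; CONTAINS the
one-intermediary channel and the squeeze within t_c) number ≤ C·s·V_(d−1)η in the mean; (c′) for
every bounded measurable test function of (past of the tagged sphere, mark (ω,v*) of its next
collision) the mean defect against the FLUX-weighted law ∝ ((v*−v)·ω)₊M(v*) is ≤ C·(V_(d−1)η +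
d·(V_(d−1)η)^(d−1)). Evolved-law version = layer-2 use, informal. [difficulty: open-problem] (why it
might fail: (c′) is long-time molecular chaos at FIXED K_d over unbounded collision sequences; only
finite-window versions are theorems (Lanford1975, GST2013 Ch. 12, BGSSAnnals2023); O(1/K_d) errors
per collision do not vanish in N.) [Cohen1967, GST2013, Lanford1975, BGSSAnnals2023, CIP1994,
ElskensFrisch1988, AgoritsasMaimbourgZamponi2019, BoblylevPulvirentiSaffirio2012]
#9 MarginalsToFieldsAllDim (support) — d-generic MARGINALS ⇒ FIELDS (Sznitman-type variance
computation + Chebyshev, the d-dim twin of DenseKineticExpansion's MarginalsToL2 0806 pushed to the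
in-probability form): for d ≥ 3, σ > 0, continuous profiles, continuous (ρ_t,u_t,θ_t) with θ_t > 0,
flows Φ and t: if the time-t density W_N(t) is a.e. permutation-symmetric for every N, its
1-marginal → ρ_tM_(u_t,θ_t) in (1+|v|²)²-weighted L¹ and its 2-marginal − product → 0 in weighted
L¹, then the empirical density/momentum/energy fields at time t converge in probability to (ρ_t,
ρ_tu_t, ρ_t(|u_t|²/2 + dθ_t/2)) tested against every continuous χ. [difficulty: provable-now]
[Sznitman1991, GST2013, Spohn1991]
#9 FlowRelabelSymmetry (support) — RELABELLING SYMMETRY: for d ≥ 3, σ > 0, profiles, any family of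
hard-sphere flows, t, N and any permutation π of the N+1 labels, the time-t density 1_D·(canonical
local Gibbs density ∘ Φ_N(−t)) is a.e. invariant under z ↦ z∘π (canonical density and hard-sphere
domain are symmetric; a relabelled hard-sphere trajectory is a hard-sphere trajectory, so by
IsHardSphereTrajectory.unique_holds / HardSphereFlow.flow_eq_ae_holds the flow commutes with
relabelling off a null set). Discharges the symmetry hypothesis of MarginalsToFieldsAllDim for every
HardSphereFlow (the structure carries no equivariance field). [difficulty: provable-now] [GST2013,
Alexander1975, CIP1994]
#9 GrazingDeflectionMoment (support) — GENTLE KICKS (mechanism (ii), elementary): under the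
hard-sphere cross-section law in dimension d (impact parameter b uniform on the unit (d−1)-ball,
deflection angle of the relative velocity χ = 2 arccos|b|) the mean-square deflection is at most
π²/d: ∫_(|b|<1) (2 arccos|b|)² db ≤ (π²/d)·vol(B^(d−1)) for every d ≥ 2 (proof: 4 arccos² r ≤
π²(1−r) on [0,1] by concavity, and E[1−|b|] = 1/d under the rim law (d−1)r^(d−2)dr; numerically
LHS/vol ≈ 8/d). Records the quantitative grazing dominance used by the engine at the top rung.
[difficulty: provable-now] [ElskensFrisch1988, AgoritsasMaimbourgZamponi2019, CIP1994]
#9 DimThreeGlue (support) — d = 3 SPECIALISATION: the d = 3 member of the inlined d-generic guarded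
statement (UnitAddTorus (Fin 3), exponent 1/↑3, energy ρ(|u|²/2 + ↑3/2·θ), pressure ρθ(1 + η
f_ex′(η)) from the d = 3 free volume) implies the library-typed guarded conjunct (now =
HydrodynamicLimit itself; historically HydroLimitInBand, stmt 3093: hsDiameter, localGibbsLaw,
IsHardSphereEulerSolution, TendstoHydroFieldsAt, totalEnergyDensity, hsPressure); `closes` performs
this unfolding inline. Pure unfolding plus Nat.cast bookkeeping ((3:ℕ):ℝ) = 3 (the three defining
identities are checked by `simp` in the planner's Sketch.lean). [difficulty: provable-now]
[Spohn1991, Literature.MathematicalPhysics.KineticTheory.HydrodynamicLimit (HardSphereEuler.lean)]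
(DiluteSelfConsistency, stmt 3091 — the σ-uniform packing bound that fed the UNGUARDED conjunct —
was detached on 2026-08-16 after the statement re-type p126922 made the packing guard a hypothesis
of HydrodynamicLimit; it is no longer load-bearing here and stays with the routes that target the
unguarded Literature limit.)

TWO-LAYER PLAN. Foreseen glued splits (nothing filed now). HighDimensionEuler ⇐
HighDimLocalEquilibrium (∃ d₀ ∀ d ≥ d₀ form of the engine) → [MarginalsToFieldsAllDim,
FlowRelabelSymmetry] → HighDimensionEuler (k = 1 + glue; the glue is allDim_of_engine restricted to
d ≥ d₀). HighDimLocalEquilibrium ⇐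
FreshPartnerStatisticsR (card D1, rank 4; REPAIRED and typed at equilibrium on 2026-08-16 after
crux-attack rattack-9750-0 refuted the informal
stmt-9750 as misstated: cut at ONE MEAN FREE PATH ℓ instead of a fixed multiple of t_c; N ≥ N₀;
Stosszahlansatz in the MEAN over pasts;
FLUX-weighted reference law — see RANKED CRUXES #4; its evolved-law version is the layer-2 use) →
GrazingKickRelaxation (OU/Landau-type relaxation of the tagged velocity in ≍ d
collisions, the CLT over fresh grazing kicks; BoblylevPulvirentiSaffirio2012, doi:10.1002/cpa.70035
for the linearised Landau long-time technology)
→ DressedContraction_d (cumulant hierarchy relative to local Gibbs with collision-dressed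
propagators contracts for d ≥ d₀) → HighDimLocalEquilibrium
(k = 3). Card R1 (DimensionAsymptoticEuler: accuracy δ*(d) → 0 at fixed η via finite equilibrium
windows τ₀ ≍ r_d^-1, conditional on the long-time
equilibrium fluctuation technology of iterated-limit-euler-finite-windows — audit design point 2)
becomes a child of HighDimensionEuler once a
d-uniform profile class (C^k bounds Λ on data AND solution) is fixed; it is not typed now because d₀
must depend on Λ. LocalEquilibriumAllDim at
d = 3 ⇐ the DenseKineticExpansion children of 0804 with the constant read as a creation/destruction
ratio (attacked last).

KILL CRITERIA. Refutation of HighDimensionEuler (e.g. a d-uniform obstruction: an O(1)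
non-hydrodynamic memory of the tagged sphere or O(1) long-range dynamical
pair correlations on Euler times for every d, or failure of the fixed-density LLN in some high d)
removes the top of the ladder — close
`refuted:HighDimensionEuler`. Refutation of LocalEquilibriumAllDim through its d = 3 member while
HighDimensionEuler stands turns the route into an
analogue programme with no path to the conjunct — close `superseded` in favour of whichever d = 3
route survives, keeping the rung as a Literature
target. DenseExcursion (3090) / ¬DiluteSelfConsistency no longer bear on this route (since the
re-type p126922 an imploding solution is outside the
conjunct's scope and DiluteSelfConsistency is detached). The guarded conjunct or L2HydroFields
proved by any other route moots the
d = 3 payoff (close `superseded`; rungs survive as analogue theorems). A computation showing any of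
the three suppressions is only POLYNOMIAL in d at
fixed η (as happened at fixed second-virial density) retires the rationale — pivot or close
`refuted:HighDimensionEuler` after refuter evidence.

NOT DECOMPOSED YET. The cumulant/cluster vocabulary relative to local Gibbs (shared need with
DenseKineticExpansion 0804) and hence the dressed-contraction form of the
engine; the EVOLVED-LAW (local Gibbs, packing-guarded) version of FreshPartnerStatisticsR and
GrazingKickRelaxation (the equilibrium member is typed since
rev 7 over Literature.Analysis.FluidPDE.HardSphereCollisionRecord: Collide, collisionTimesOf,
HardSphereFlow.nthRecordOf);
the d-uniform profile class for R1; the explicit functions η₀(d), d₀, C_d(η); velocity-tail control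
in d dimensions (HighMomentumCutoff analogue,
eased by concentration of |v|²/d — routed to card apriori-tails-and-rattlers at d = 3); the
Enskog-contact correction carrying Z_d − 1 ≍ V_dη/2
(superexponentially small but nonzero at the top rung). All are layer-2 children after
HighDimensionEuler or LocalEquilibriumAllDim moves.

CHEAPEST FALSIFIER. One page of arithmetic (redo independently; see Numbers): at FIXED η = ρσ^d, (a)
K_d = ℓ/ε = 1/(V_(d−1)η) → ∞ superexponentially (top
rung kinetically dilute — conceded); (b) LOCAL recollisions — a second meeting of the same pair
before they separate by one mean free path ℓ — cost ONE power of density,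
≍ C/K_d per collision: the squeeze within the collision duration t_c (≍ t_c/t_mft = 1/K_d; the
events that killed hilbert-six-in-log-dimensions at
fixed second-virial density, where ℓ/ε → 0) AND the one-intermediary channel (1,2)(1,3)(1,2) at c·ε
< r < ℓ (≍ e^(−Θ(d))/K_d; refuter
rattack-9750-0's witness against the old cut at a fixed multiple of t_c; GST2013 Prop. 8.4.1 shape)
— here 1/K_d = V_(d−1)η is superexponentially
small; (c) DISTANT recollisions, after separation ≥ ℓ, cost the aiming factor (ε/r)^(d−1) ≤
K_d^-(d−1) per attempt, summable over later flights for
d ≥ 4 (Cohen1967 §2; GST2013 Prop. 9.1.1 shape); (d) E[χ²] ≤ π²/d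
(GrazingDeflectionMoment; numerically ≈ 8/d). If (b) or (c) is only polynomial in d at fixed η, or
if the LLN hypothesis at t = 0 were
unsatisfiable in high d (vacuous rung — it is not: partition functions positive for σ small, statics
superexponentially ideal,
WylerRivierFrisch1987), the line dies. Second cheapest: does ElskensFrisch1988 or the DMFT
literature exhibit a d-uniform NON-hydrodynamic memory
term at fixed η (they sit at φ̂ = 2^dφ/d = O(1), far denser; at fixed η I expect none)?

NUMBERS. K_3 = 1/(πη) (ε/ℓ = πη at d = 3, ℓ = 1/(Nπε²), Nε³ = η); K_d = 1/(V_(d−1)η), V_(d−1) =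
π^((d−1)/2)/Γ((d+1)/2) ≍ (2πe/d)^(d/2): at η = 0.1,
K_3 ≈ 3.2, K_6 ≈ 1.9, K_10 ≈ 3.0, K_12 ≈ 5.3, K_15 ≈ 17, K_20 ≈ 2.1·10², K_25 ≈ 5.2·10³, K_30 ≈
2.1·10⁵ (recomputed 2026-08-16: V_19 = 4.66·10⁻², V_29 = 4.83·10⁻⁵;
the earlier K_20 ≈ 1.7·10³, K_30 ≈ 4.6·10⁶ were overstated (refuter rattack-9750-0);
(V_(d−1)η)^(d−1) = 5.0·10⁻⁴⁵ at d = 20; the suppression only bites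
beyond d ≈ 12 at this η — d₀ is not small).
Mean-square deflection ≤ π²/d (≈ 8.0/d asymptotically; 2.93 at d = 3, 0.41 at d = 20). Collisions
per particle per unit macroscopic time ≍
N^(1/d)·V_(d−1)η·⟨|v_rel|⟩/σ → ∞ in every d (Kn = K_d σ N^(-1/d)). Z_d(η) − 1 = V_dη/2 + O((V_dη)²)
(second virial 2^(d−1)v_d in packing units;
WylerRivierFrisch1987). Ring logarithm first at the (d+1)-body term, order η^(d−1) log η (Cohen1967
§4d for d = 3: n² log n from the four-body
term; van Leeuwen–Weijland φ_s^l ∼ ln z at l = s). Lanford validity time ≈ 0.2 mean free times in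
every d (GST2013). Items at open: 9 typed (+1
informal crux filed after open; stmt-9750, refuted as misstated, replaced 2026-08-16 by the typed
crux FreshPartnerStatisticsR, stmt-14402, rev 7).

DEFINITION REQUESTS. (1) `HydrodynamicLimitDim (d : ℕ) (σ : ℝ) : Prop` and its packing-guarded
variant in Literature/MathematicalPhysics/KineticTheory (card D4): the
d-generic twins of hsFreeVolume/hsExcessFreeEnergy/hsCompressibility/hsPressure (exponent 1/d),
totalEnergyDensity (dθ/2), IsHardSphereEulerSolution,
hsDiameter, localGibbsLaw, empirical fields, TendstoHydroFieldsAt, HydrodynamicLimitFor — so that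
the 3–4 kB inlined items of this route can be
restated compactly (`ledger workitem add --kind definition --notion HydrodynamicLimitDim …` filed
after open, --for AllDimensionEuler).
(2) Cumulants of the time-t law relative to the local hard-sphere Gibbs state (shared with
DenseKineticExpansion 0804) and recollision counts along
HardSphereFlow trajectories — the latter now exist
(Literature.Analysis.FluidPDE.HardSphereCollisionRecord; KineticTheory.BackwardCluster) and are
used by FreshPartnerStatisticsR; the cumulant vocabulary stays deferred until a crux moves.

CONE AUDIT AND STATUS (route-repair pass 2026-08-15, unit
rrepair-AtomisticToContinuum-Dimension-94eb196d-g2). needs-fact: NONE. The "4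
unproved named facts" counted in this route's IMPORT cone are the summit's four open conjuncts —
Literature.MathematicalPhysics.KineticTheory.HydrodynamicLimit (the UNGUARDED limit; until p126922
the Statement body, since then only
the antecedent of HydrodynamicLimit.of_unguarded in the Statement file — never a hypothesis here),
Literature.MathematicalPhysics.KineticTheory.HeatConduction.FouriersLaw,
Literature.MathematicalPhysics.StatisticalMechanics.Crystallization and
Literature.MathematicalPhysics.QuantumManyBody.BoseGas.BoseEinsteinCondensation
— which ride in on the operator Statement files (they come with the automatic
Summits.AtomisticToContinuum.Statement import), so no import of this route can be dropped and no
crux rests on them. Every other cite-tagged closed Prop in the Literature cone has a `_holds`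
witness in the tree (checked name by name); the items rest on Literature
DEFINITIONS plus Mathlib only (rev 7, 2026-08-16: +
Literature.Analysis.FluidPDE.HardSphereCollisionRecord for FreshPartnerStatisticsR; deps audit 0
unproved / 77 consts).
Status notes for the next planner: (i) route ImplosionLoophole, its items HydroLimitInBand (stmt
3093) / Assembly 3098 / DenseExcursion 3090, and
route DenseKineticExpansion named above were retired in the 13:41–13:47Z not-a-thesis purge —
formally this route is unaffected (DimThreeGlue
INLINES the guarded d = 3 conjunct; DiluteSelfConsistency 3091, detached here on 2026-08-16, stays a
shared item of other routes), the references are historical;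
(ii) definition request (1) has LANDED as
Literature/MathematicalPhysics/KineticTheory/HardSphereEulerDim.lean (HydrodynamicLimitDim d,
HydroLimitInBandDim d, hydroLimitInBandDim_iff d ↔ the form inlined by AllDimensionEuler /
HighDimensionEuler, hydrodynamicLimitDim_three_iff :
HydrodynamicLimitDim 3 ↔ HydrodynamicLimit, hydroLimitInBandDim_three_iff) — a compact restatement
of the 3–4 kB inlined items is tenure work
(it re-keys the items and their stamps), deliberately not done in this guardrail pass; (iii) the
route review of 14:37Z (grade variant, SURVIVES)
left two layer objections for tenure: HighDimensionEuler (rank 2) is off the `closes` path and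
implied by the target, and LocalEquilibriumAllDim is
typed ∀ d ≥ 3 while `closes` consumes its d = 3 member only (candidate glued split: a d = 3 member
on the path + the ∀ d form as the rung above it).

Novelty: Searches (2026-08-15; local searchd down, OpenAlex/S2/arXiv HTTP 429, Crossref and galaxy live):
`lit frontier AtomisticToContinuum --since 2020`
(30 rows; relevant: doi:10.1002/cpa.70035 long-time linearised Boltzmann/Landau from particles,
arXiv:2602.04407 Bourbaki on Deng–Hani–Ma; nothing
dimension-indexed); `lit search --source crossref "hard spheres infinite dimensions kinetic theory
dynamics"` (8: ElskensFrisch1988 =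
doi:10.1103/physreva.37.4351, ParisiUrbaniZamponi2019 chapters doi:10.1017/9781108120494.003/.004);
`… "Lanford theorem validity Boltzmann equation
arbitrary dimension"` (8, none on d-dependence); `… "dynamical mean field theory hard spheres large
dimension liquids"` (8, electronic DMFT only);
`… "hydrodynamic limit hard sphere gas high dimensional"` (8, none); `lit galaxy search "spheres in
infinite dimensions" --star all` (8: Altieri
thesis, Biroli–Urbani arXiv:1704.04649, Spigler thesis — glass/jamming physics); `lit galaxy search
"hard spheres in high dimensions dynamics
kinetic theory" --star all` (0); plus the card's own sweep (crossref ×6, arXiv ×2, all 27 cards then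
on the board) and its audit (refuter 6-0:
"rigorous use of d → ∞ for hard-sphere DYNAMICS: none found"; added AgoritsasMaimbourgZamponi2019,
Manacorda–Schehr–Zamponi 2020, Charbonneau et
al. MD to d ≈ 13). Board: 7 route files read (none dimension-indexed); retired companions
hilbert-six-in-log-dimensions (refuted) and
sigma-asymptotic-euler (superseded) read and steered around.
Nearest  [refs: 10.1002/cpa.70035, 10.1103/physreva.37.4351, 10.1017/9781108120494.003/.004, 10.1103/physreva.37.4351:, 2602.04407, 1704.04649, 2503.01800, doi:10.1002/cpa.70035, doi:10.1103/physreva.37.4351, doi:10.1017/9781108120494.003/.004, ElskensFrisch1988, ParisiUrbaniZamponi2019, AgoritsasMaimbourgZamponi2019, MaimbourgKurchanZamponi2016, BoblylevPulvirentiSaffirio2012, Lanford1975, GST2013, BGSSAnnals202]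

Barriers (technique_class: toy-ladder high-dimension dynamical-cumulant-hierarchy): - technique_class: toy-ladder high-dimension dynamical-cumulant-hierarchy
- Literature.Barriers.AtomisticToContinuum.NoDensityExpansionBarrier: applies to
LocalEquilibriumAllDim (a dynamical cumulant expansion). Evasion as in the barrier's own sources
(Cohen1967 §4a–b): cumulants RELATIVE to local Gibbs, collision-dressed (mean-free-path cut-off)
propagators, no term-by-term free-streaming expansion; and at the top rung the first logarithm sits
at order η^(d−1) (van Leeuwen–Weijland l = s rule), below any accuracy used. At d = 3 the barrier is
not evaded, only quantified (ring order (πη)², η small) — conceded; kill criterion names it.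
- Literature.Barriers.AtomisticToContinuum.DiluteRegimeBarrier: in letter not met ((N+1)ε^d = σ^d
fixed in every rung, EOS = Z_d, no Boltzmann–Grad sequence). In spirit PARTLY met and said so: at
fixed η the top rung has ε/ℓ = V_(d−1)η superexponentially small and Z − 1 superexponentially small,
so the d-descent is the dilute → dense interpolation relabelled; the bet is that the descent is
quantitative (explicit C_d(η)) inside ONE typed family, which the σ-axis (iterated limits) does not
offer, and that the particle → Enskog-type step the barrier's scope caveat (4) names as the real
open problem is exactly LocalEquilibriumAllDim.
- Literature.Barriers.AtomisticToContinuum.BoltzmannHypothesisBarrier: no entropy method and no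
classification of stationary states is used (scope (d): the barrier obstructs closures THROUGH the
infinite-volume classifi

Novelty grade: variant — ROUTE REVIEW (refuter rreview-0815T13-18-0): SURVIVES with two LAYER OBJECTIONS, no false statement (pool refuters g41-12/g40-0 stamped 14:31–14:33Z; deltas here). Conforming refile of LargeDimensionLadder; 9/9 live decls rc0 (W3.lean); Assembly PROVED (`closes`, std axioms; candidate on 9349). OBJE (refuter refuter-rreview-0815T13-18-0, 2026-08-15T14:37:35Z; prior: doi:10.1103/physreva.37.4351 (Elskens-Frisch 1988), MaimbourgKurchanZamponi2016 PRL 116 015902, Lanford1975, GST2013 arXiv:1208.5753, Cohen1967)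

History (route lifecycle, newest last):
- 2026-08-16T03:07:44Z · rev 5: dropped AllDimOfEngine — route-choice (a) step 1/3: detach the just-filed glue item AllDimOfEngine (stmt-AtomisticToContinuum-14165, rank 9) so it can be re-attached at rank 10 — the ga (planner-rchoice-AtomisticToContinuum-Dimension-e23caff9-0)
- 2026-08-16T03:08:48Z · rev 5: dropped stmt-AtomisticToContinuum-9750 — route-repair (badge, planner rbadge 2026-08-16): (1) gate stamp route.target-unreachable — add the support glue item EngineToAllDim : LocalEquilibriumAllDim → M (planner-rbadge-AtomisticToContinuum-DimensionL-94eb196d-0)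
- 2026-08-16T03:14:04Z · rev 5: dropped AllDimOfEngine — route-choice (a) step 1/3: detach the just-filed glue item AllDimOfEngine (stmt-AtomisticToContinuum-14165, rank 9) so it can be re-attached at rank 10 — the ga (planner-rchoice-AtomisticToContinuum-Dimension-e23caff9-0)
- 2026-08-16T03:42:37Z · AUTO-CRUX (edit): AllDimensionEuler — hypotheses of the deciding theorem that nothing in the route derives are cruxes (planner-rchoice-AtomisticToContinuum-Dimension-e23caff9-0)
- 2026-08-16T04:09:39Z · rev 17: dropped stmt-AtomisticToContinuum-3091 — route-repair (badge, planner rbadge) — RANK FIX for the shared crux DiluteSelfConsistency (stmt-3091): detach the rank-9 attachment and re-attach the SAME state (planner-rbadge-AtomisticToContinuum-DimensionL-94eb196d-0)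
- 2026-08-16T23:14:22Z · rev 19: restated Assembly (stmt-AtomisticToContinuum-9349) — route-repair (statement-revised p126922) step 2/3 — header + Assembly sync after the rev-18 re-cut of closes: (i) restate the assembly item Assembly (stmt-9349) (planner-rrepair-AtomisticToContinuum-Dimension-b5494021-0)
- 2026-08-16T23:15:04Z · rev 20: dropped DiluteSelfConsistency — route-repair (statement-revised p126922) step 3/3 — detach the shared crux DiluteSelfConsistency (stmt-AtomisticToContinuum-3091, rank 5 here) from THIS route: (planner-rrepair-AtomisticToContinuum-Dimension-b5494021-0)
- 2026-08-22T19:33:06Z · DORMANT — reconciler: no traction for 5.6 d (last activity item-evidence-added at 2026-08-17T04:27:27Z); parked, not closed — `ledger route dormant route-AtomisticToConti (operator:999:3710555)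

sub-problem: HydrodynamicLimit · status: dormant · opened planner-plancard-AtomisticToContinuum-Hydrody-8e92f730-0 2026-08-15T13:56:10Z · rev 23 · ledger route-AtomisticToContinuum-DimensionLadder
GENERATED by the gate from the ledger (D-0016/17). Provers cite these decls: `theorem foo : Summit.AtomisticToContinuum.HydrodynamicLimit.Theses.DimensionLadder.<Decl> := …` in Summits/AtomisticToContinuum/HydrodynamicLimit/Theorems/<Name>.lean.
-/

namespace Summit.AtomisticToContinuum.HydrodynamicLimit.Theses.DimensionLadder

open scoped BigOperators Topology Manifold Classical MeasureTheory ProbabilityTheory Matrix InnerProductSpace ComplexConjugate ContinuousMap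
open Filter Set Function TopologicalSpace MeasureTheory

attribute [summit_statement] _root_.HydrodynamicLimit

/-- item stmt-AtomisticToContinuum-9342 · crux (kind.auto-crux: conjecture-grade) · rank 0 · open · by planner
why it might fail: Contains the guarded d = 3 conjunct; and d-uniformity may fail the other way: for d = 3,4 the engine's constant C_d(η₀) < 1 may force η₀(d) far below any physically dilute density, i.e. the ladder may not reach the ground.
sources: Spohn1991, OllaVaradhanYau1993, Cohen1967, ElskensFrisch1988
[target] X: for every d ≥ 3 there is η₀(d) > 0 such that for all continuous positive profiles on 𝕋^d
there is σ₀ with: for σ < σ₀, every classical d-dimensional hard-sphere Euler solution on [0,T) with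
packing ρ_tσ^d < η₀ and every family of hard-sphere flows, LLN of the empirical
density/momentum/energy fields under the local Gibbs law at t = 0 implies LLN at every t < T
(d-generic packing-guarded conjunct, inlined; d = 3 member = HydroLimitInBand 3093 via
DimThreeGlue). Follows from LocalEquilibriumAllDim + MarginalsToFieldsAllDim + FlowRelabelSymmetry
(theorem allDim_of_engine in the planner's Sketch.lean). -/
@[route_item "route-AtomisticToContinuum-DimensionLadder", crux]
def AllDimensionEuler : Prop :=
  ∀ d : ℕ, 3 ≤ d → ∃ η₀ : ℝ, 0 < η₀ ∧ ∀ (a₀ θ₀ : UnitAddTorus (Fin d) → ℝ) (u₀ : UnitAddTorus (Fin d) → EuclideanSpace ℝ (Fin d)), Continuous a₀ → Continuous θ₀ → Continuous u₀ → (∀ x, 0 < a₀ x) → (∀ x, 0 < θ₀ x) → ∃ σ₀ : ℝ, 0 < σ₀ ∧ ∀ σ : ℝ, 0 < σ → σ < σ₀ → let G := Literature.Analysis.FluidPDE.Torus.geometry (Fin d); let ε := fun N : ℕ => σ * ((N + 1 : ℕ) : ℝ) ^ (-(1 / (d : ℝ))); let f₀ := fun y : UnitAddTorus (Fin d) ×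 EuclideanSpace ℝ (Fin d) => a₀ y.1 * Literature.Analysis.FluidPDE.localMaxwellian 1 (θ₀ y.1) (u₀ y.1) y.2; ∀ (T : ℝ) (ρ θ : ℝ → UnitAddTorus (Fin d) → ℝ) (u : ℝ → UnitAddTorus (Fin d) → EuclideanSpace ℝ (Fin d)), let Z := fun η : ℝ => 1 + η * deriv (fun η' : ℝ => limsup (fun n : ℕ => -(n : ℝ)⁻¹ * Real.log (volume {q : Fin n → UnitAddTorus (Fin d) | ∀ i j, i ≠ j → (η' / n) ^ (1 / (d : ℝ)) < Literature.Analysis.FluidPDE.Torus.euclidDist (q i) (q j)}).toReal) atTop) η; let P := fun r ϑ : ℝ => r * ϑ * Z (r * σ ^ d); let E := fun (r : ℝ) (w : EuclideanSpace ℝ (Fin d)) (ϑ : ℝ) => r * (‖w‖ ^ 2 / 2 + (d : ℝ) / 2 * ϑ); Literature.Analysis.FunctionSpaces.Torus.IsSmoothSpaceTimeOn (Ico 0 T) ρ → Literature.Analysis.FunctionSpaces.Torus.IsSmoothSpaceTimeOn (Ico 0 T) u → Literature.Analysis.FunctionSpaces.Torus.IsSmoothSpaceTimeOn (Ico 0 T)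 θ → (∀ t ∈ Ico 0 T, ∀ x, 0 < ρ t x) → (∀ t ∈ Ico 0 T, ∀ x, 0 < θ t x) → (∀ t ∈ Ico 0 T, ∀ x, Literature.Analysis.FunctionSpaces.Torus.timeDerivWithin (Ico 0 T) ρ t x + Literature.Analysis.FunctionSpaces.Torus.divergence (fun y => ρ t y • u t y) x = 0) → (∀ t ∈ Ico 0 T, ∀ x, Literature.Analysis.FunctionSpaces.Torus.timeDerivWithin (Ico 0 T) (fun s y => ρ s y • u s y) t x + (∑ i, Literature.Analysis.FunctionSpaces.Torus.partialDeriv i (fun y => (ρ t y * u t y i) • u t y) x) + Literature.Analysis.FunctionSpaces.Torus.gradient (fun y => P (ρ t y) (θ t y)) x = 0) → (∀ t ∈ Ico 0 T, ∀ x, Literature.Analysis.FunctionSpaces.Torus.timeDerivWithin (Ico 0 T) (fun s y => E (ρ s y) (u s y) (θ s y)) t x + Literature.Analysis.FunctionSpaces.Torus.divergence (fun y => (E (ρ t y) (u t y) (θ t y) + P (ρ t y) (θ t y)) • u t y) x = 0) → (∀ t ∈ Ico 0 T, ∀ x, ρ t x * σ ^ d < η₀) → ∀ Φ : (N : ℕ)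 → Literature.Analysis.FluidPDE.HardSphereFlow G (ε N) (N + 1), let L := fun N : ℕ => Literature.Analysis.FluidPDE.particleLaw (Φ N) (Literature.Analysis.FluidPDE.canonicalDensity G (ε N) (N + 1) f₀); let Tend := fun t : ℝ => ∀ χ : UnitAddTorus (Fin d) → ℝ, Continuous χ → ∀ δ > (0 : ℝ), Tendsto (fun N => L N {z | δ < |(∫ y, χ y.1 ∂Literature.Analysis.FluidPDE.empiricalMeasure ((Φ N).flow t z)) - ∫ x, χ x * ρ t x|}) atTop (nhds 0) ∧ Tendsto (fun N => L N {z | δ < ‖(∫ y, χ y.1 • y.2 ∂Literature.Analysis.FluidPDE.empiricalMeasure ((Φ N).flow t z)) - ∫ x, (χ x * ρ t x) • u t x‖}) atTop (nhds 0) ∧ Tendsto (fun N => L N {z | δ < |(∫ y, χ y.1 * (‖y.2‖ ^ 2 / 2) ∂Literature.Analysis.FluidPDE.empiricalMeasure ((Φ N).flow t z)) - ∫ x, χ x * E (ρ t x) (u t x) (θ t x)|}) atTop (nhds 0); Tend 0 → ∀ t ∈ Ico 0 T, Tend t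

/-- item stmt-AtomisticToContinuum-9343 · crux · rank 2 · open · by planner
why it might fail: Even at d ≫ 1 each sphere makes ≍ N^(1/d)·V_(d-1)η√d/σ → ∞ collisions per unit time: decorrelation over unbounded collision sequences is unproved in ANY d (Lanford radius ≈ 0.2 mft is combinatorial, d-independent); MKZ's d = ∞ dynamics is physics-level and dense (φ̂ = O(1)).
sources: Lanford1975, GST2013, BGSSAnnals2023, MaimbourgKurchanZamponi2016, AgoritsasMaimbourgZamponi2019, ElskensFrisch1988
[crux] TOP RUNG (card R2): there is d₀ such that for every d ≥ d₀ the packing-guarded fixed-density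
Euler limit holds on 𝕋^d (same inlined statement as the target, ∃ d₀ ∀ d ≥ d₀). The rung where all
three suppressions (strangers K_d^-(d-1), gentle kicks π²/d, memory t^(-d/2)) are available; the
informative first theorem of the ladder and the calibration point for the d = 3 engine
(DenseKineticExpansion 0804). [difficulty: open-problem] -/
@[route_item "route-AtomisticToContinuum-DimensionLadder"]
def HighDimensionEuler : Prop :=
  ∃ d₀ : ℕ, ∀ d : ℕ, d₀ ≤ d → ∃ η₀ : ℝ, 0 < η₀ ∧ ∀ (a₀ θ₀ : UnitAddTorus (Fin d) → ℝ) (u₀ : UnitAddTorus (Fin d) → EuclideanSpace ℝ (Fin d)), Continuous a₀ → Continuous θ₀ → Continuous u₀ → (∀ x, 0 < a₀ x) → (∀ x, 0 < θ₀ x) → ∃ σ₀ : ℝ, 0 < σ₀ ∧ ∀ σ : ℝ, 0 < σ → σ < σ₀ → let G := Literature.Analysis.FluidPDE.Torus.geometry (Fin d); let ε := fun N : ℕ => σ * ((N + 1 : ℕ) : ℝ) ^ (-(1 / (d : ℝ))); let f₀ := fun y : UnitAddTorus (Fin d) × EuclideanSpace ℝ (Fin d) => a₀ y.1 * Literature.Analysis.FluidPDE.localMaxwellian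 1 (θ₀ y.1) (u₀ y.1) y.2; ∀ (T : ℝ) (ρ θ : ℝ → UnitAddTorus (Fin d) → ℝ) (u : ℝ → UnitAddTorus (Fin d) → EuclideanSpace ℝ (Fin d)), let Z := fun η : ℝ => 1 + η * deriv (fun η' : ℝ => limsup (fun n : ℕ => -(n : ℝ)⁻¹ * Real.log (volume {q : Fin n → UnitAddTorus (Fin d) | ∀ i j, i ≠ j → (η' / n) ^ (1 / (d : ℝ)) < Literature.Analysis.FluidPDE.Torus.euclidDist (q i) (q j)}).toReal) atTop) η; let P := fun r ϑ : ℝ => r * ϑ * Z (r * σ ^ d); let E := fun (r : ℝ) (w : EuclideanSpace ℝ (Fin d)) (ϑ : ℝ) => r * (‖w‖ ^ 2 / 2 + (d : ℝ) / 2 * ϑ); Literature.Analysis.FunctionSpaces.Torus.IsSmoothSpaceTimeOn (Ico 0 T) ρ → Literature.Analysis.FunctionSpaces.Torus.IsSmoothSpaceTimeOn (Ico 0 T) u → Literature.Analysis.FunctionSpaces.Torus.IsSmoothSpaceTimeOn (Ico 0 T) θ → (∀ t ∈ Ico 0 T, ∀ x, 0 < ρ t x) → (∀ t ∈ Ico 0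 T, ∀ x, 0 < θ t x) → (∀ t ∈ Ico 0 T, ∀ x, Literature.Analysis.FunctionSpaces.Torus.timeDerivWithin (Ico 0 T) ρ t x + Literature.Analysis.FunctionSpaces.Torus.divergence (fun y => ρ t y • u t y) x = 0) → (∀ t ∈ Ico 0 T, ∀ x, Literature.Analysis.FunctionSpaces.Torus.timeDerivWithin (Ico 0 T) (fun s y => ρ s y • u s y) t x + (∑ i, Literature.Analysis.FunctionSpaces.Torus.partialDeriv i (fun y => (ρ t y * u t y i) • u t y) x) + Literature.Analysis.FunctionSpaces.Torus.gradient (fun y => P (ρ t y) (θ t y)) x = 0) → (∀ t ∈ Ico 0 T, ∀ x, Literature.Analysis.FunctionSpaces.Torus.timeDerivWithin (Ico 0 T) (fun s y => E (ρ s y) (u s y) (θ s y)) t x + Literature.Analysis.FunctionSpaces.Torus.divergence (fun y => (E (ρ t y) (u t y) (θ t y) + P (ρ t y) (θ t y)) • u t y) x = 0) → (∀ t ∈ Ico 0 T, ∀ x, ρ t x * σ ^ d < η₀) → ∀ Φ : (N : ℕ) → Literature.Analysis.FluidPDE.HardSphereFlow G (ε N) (N + 1), let L := fun N : ℕ =>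 Literature.Analysis.FluidPDE.particleLaw (Φ N) (Literature.Analysis.FluidPDE.canonicalDensity G (ε N) (N + 1) f₀); let Tend := fun t : ℝ => ∀ χ : UnitAddTorus (Fin d) → ℝ, Continuous χ → ∀ δ > (0 : ℝ), Tendsto (fun N => L N {z | δ < |(∫ y, χ y.1 ∂Literature.Analysis.FluidPDE.empiricalMeasure ((Φ N).flow t z)) - ∫ x, χ x * ρ t x|}) atTop (nhds 0) ∧ Tendsto (fun N => L N {z | δ < ‖(∫ y, χ y.1 • y.2 ∂Literature.Analysis.FluidPDE.empiricalMeasure ((Φ N).flow t z)) - ∫ x, (χ x * ρ t x) • u t x‖}) atTop (nhds 0) ∧ Tendsto (fun N => L N {z | δ < |(∫ y, χ y.1 * (‖y.2‖ ^ 2 / 2) ∂Literature.Analysis.FluidPDE.empiricalMeasure ((Φ N).flow t z)) - ∫ x, χ x * E (ρ t x) (u t x) (θ t x)|}) atTop (nhds 0); Tend 0 → ∀ t ∈ Ico 0 T, Tend t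

/-- item stmt-AtomisticToContinuum-9344 · crux · rank 3 · open · by planner
why it might fail: At d = 3 it is the fixed-density Boltzmann property relative to local Gibbs over ≍N^(1/3) collision times (Spohn1991 I.3: no proof); hydrodynamic (conserved-mode) pair correlations are not damped by collisions and ring resummation completeness is unproved (Cohen1967 §4c-d) — uniformly in d.
sources: Cohen1967, Spohn1991, PulvirentiSimonella2016, BGSSAnnals2023, DengHaniMa2024, arXiv:2503.01800
[crux] THE d-UNIFORM ENGINE (card D2 DressedContraction, typed shadow; d = 3 member =
packing-guarded form of DenseKineticExpansion's FixedFractionCumulantExpansion 0804): for every d ≥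
3 there is η₀(d) > 0 such that for all profiles ∃ σ₀ ∀ σ < σ₀, every guarded classical d-dim
hs-Euler solution, every flow family with LLN at t = 0, and every t < T: the 1-particle marginal of
the time-t density W_N(t) = 1_D · (canonical local Gibbs density ∘ Φ_(-t)) converges in
(1+|v|²)²-weighted L¹ to ρ_t(x)M_(1,u_t(x),θ_t(x))(v) and the 2-particle marginal minus the product
of 1-marginals tends to 0 in (1+|v|²)(1+|v′|²)-weighted L¹. Intended proof: cumulants relative to
the local hard-sphere Gibbs state, propagated by collision-dressed (mean-free-path damped)
propagators, contract uniformly on Euler times because creation (rate r_d·ν) loses to destruction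
(rate ν/d); constants explicit in (d, η), superexponentially good in d, (πη)²-type at d = 3.
[difficulty: open-problem] -/
@[route_item "route-AtomisticToContinuum-DimensionLadder"]
def LocalEquilibriumAllDim : Prop :=
  ∀ d : ℕ, 3 ≤ d → ∃ η₀ : ℝ, 0 < η₀ ∧ ∀ (a₀ θ₀ : UnitAddTorus (Fin d) → ℝ) (u₀ : UnitAddTorus (Fin d) → EuclideanSpace ℝ (Fin d)), Continuous a₀ → Continuous θ₀ → Continuous u₀ → (∀ x, 0 < a₀ x) → (∀ x, 0 < θ₀ x) → ∃ σ₀ : ℝ, 0 < σ₀ ∧ ∀ σ : ℝ, 0 < σ → σ < σ₀ → let G := Literature.Analysis.FluidPDE.Torus.geometry (Fin d); let ε := fun N : ℕ => σ * ((N + 1 : ℕ) : ℝ) ^ (-(1 / (d : ℝ))); let f₀ := fun y : UnitAddTorus (Fin d) × EuclideanSpace ℝ (Fin d) => a₀ y.1 * Literature.Analysis.FluidPDE.localMaxwellian 1 (θ₀ y.1) (u₀ y.1) y.2; ∀ (T : ℝ) (ρ θ : ℝ → UnitAddTorus (Fin d) → ℝ) (u : ℝ → UnitAddTorus (Fin d)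 → EuclideanSpace ℝ (Fin d)), let Z := fun η : ℝ => 1 + η * deriv (fun η' : ℝ => limsup (fun n : ℕ => -(n : ℝ)⁻¹ * Real.log (volume {q : Fin n → UnitAddTorus (Fin d) | ∀ i j, i ≠ j → (η' / n) ^ (1 / (d : ℝ)) < Literature.Analysis.FluidPDE.Torus.euclidDist (q i) (q j)}).toReal) atTop) η; let P := fun r ϑ : ℝ => r * ϑ * Z (r * σ ^ d); let E := fun (r : ℝ) (w : EuclideanSpace ℝ (Fin d)) (ϑ : ℝ) => r * (‖w‖ ^ 2 / 2 + (d : ℝ) / 2 * ϑ); Literature.Analysis.FunctionSpaces.Torus.IsSmoothSpaceTimeOn (Ico 0 T) ρ → Literature.Analysis.FunctionSpaces.Torus.IsSmoothSpaceTimeOn (Ico 0 T) u → Literature.Analysis.FunctionSpaces.Torus.IsSmoothSpaceTimeOn (Ico 0 T) θ → (∀ t ∈ Ico 0 T, ∀ x, 0 < ρ t x) → (∀ t ∈ Ico 0 T, ∀ x, 0 < θ t x) → (∀ t ∈ Ico 0 T, ∀ x, Literature.Analysis.FunctionSpaces.Torus.timeDerivWithin (Ico 0 T) ρ t x + Literature.Analysis.FunctionSpaces.Torus.divergence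 (fun y => ρ t y • u t y) x = 0) → (∀ t ∈ Ico 0 T, ∀ x, Literature.Analysis.FunctionSpaces.Torus.timeDerivWithin (Ico 0 T) (fun s y => ρ s y • u s y) t x + (∑ i, Literature.Analysis.FunctionSpaces.Torus.partialDeriv i (fun y => (ρ t y * u t y i) • u t y) x) + Literature.Analysis.FunctionSpaces.Torus.gradient (fun y => P (ρ t y) (θ t y)) x = 0) → (∀ t ∈ Ico 0 T, ∀ x, Literature.Analysis.FunctionSpaces.Torus.timeDerivWithin (Ico 0 T) (fun s y => E (ρ s y) (u s y) (θ s y)) t x + Literature.Analysis.FunctionSpaces.Torus.divergence (fun y => (E (ρ t y) (u t y) (θ t y) + P (ρ t y) (θ t y)) • u t y) x = 0) → (∀ t ∈ Ico 0 T, ∀ x, ρ t x * σ ^ d < η₀) → ∀ Φ : (N : ℕ) → Literature.Analysis.FluidPDE.HardSphereFlow G (ε N) (N + 1), let L := fun N : ℕ => Literature.Analysis.FluidPDE.particleLaw (Φ N) (Literature.Analysis.FluidPDE.canonicalDensity G (ε N) (N + 1) f₀); let Tend := fun t : ℝ => ∀ χ : UnitAddTorus (Fin d) → ℝ, Continuous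 χ → ∀ δ > (0 : ℝ), Tendsto (fun N => L N {z | δ < |(∫ y, χ y.1 ∂Literature.Analysis.FluidPDE.empiricalMeasure ((Φ N).flow t z)) - ∫ x, χ x * ρ t x|}) atTop (nhds 0) ∧ Tendsto (fun N => L N {z | δ < ‖(∫ y, χ y.1 • y.2 ∂Literature.Analysis.FluidPDE.empiricalMeasure ((Φ N).flow t z)) - ∫ x, (χ x * ρ t x) • u t x‖}) atTop (nhds 0) ∧ Tendsto (fun N => L N {z | δ < |(∫ y, χ y.1 * (‖y.2‖ ^ 2 / 2) ∂Literature.Analysis.FluidPDE.empiricalMeasure ((Φ N).flow t z)) - ∫ x, χ x * E (ρ t x) (u t x) (θ t x)|}) atTop (nhds 0); Tend 0 → ∀ t ∈ Ico 0 T, let W := fun N : ℕ => (Literature.Analysis.FluidPDE.hardSphereDomain G (N + 1) (ε N)).indicator (Literature.Analysis.FluidPDE.hsTransport (Φ N) t (Literature.Analysis.FluidPDE.canonicalDensity G (ε N) (N + 1) f₀)); let g := fun y : UnitAddTorus (Fin d) × EuclideanSpace ℝ (Fin d) => ρ t y.1 * Literature.Analysis.FluidPDE.localMaxwellian 1 (θ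 t y.1) (u t y.1) y.2; Tendsto (fun N : ℕ => ∫⁻ y : UnitAddTorus (Fin d) × EuclideanSpace ℝ (Fin d), ENNReal.ofReal ((1 + ‖y.2‖ ^ 2) ^ 2 * |Literature.Analysis.FluidPDE.nthMarginal (N + 1) 1 (W N) (fun _ => y) - g y|)) atTop (nhds 0) ∧ Tendsto (fun N : ℕ => ∫⁻ p : (UnitAddTorus (Fin d) × EuclideanSpace ℝ (Fin d)) × (UnitAddTorus (Fin d) × EuclideanSpace ℝ (Fin d)), ENNReal.ofReal ((1 + ‖p.1.2‖ ^ 2) * (1 + ‖p.2.2‖ ^ 2) * |Literature.Analysis.FluidPDE.nthMarginal (N + 1) 2 (W N) ![p.1, p.2] - Literature.Analysis.FluidPDE.nthMarginal (N + 1) 1 (W N) ![p.1] * Literature.Analysis.FluidPDE.nthMarginal (N + 1) 1 (W N) ![p.2]|)) atTop (nhds 0)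

/-- item stmt-AtomisticToContinuum-14402 · crux · rank 4 · open · by planner
why it might fail: (c′) is long-time molecular chaos at FIXED K_d over unbounded collision sequences (≍N^{1/d} per Euler time): only finite-window versions are theorems (Lanford1975, GST2013 Ch.12, BGSSAnnals2023, Boltzmann–Grad); O(1/K_d) per-collision errors do not vanish in N.
sources: Cohen1967, GST2013, Lanford1975, BGSSAnnals2023, CIP1994, ElskensFrisch1988
[crux] FRESH PARTNERS AND GENTLE KICKS — REPAIRED and TYPED (replaces informal
FreshPartnerStatistics stmt-9750, refuted-MISSTATED by crux-attack rattack-9750-0, 2026-08-16; its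
four repairs are built in: the local/non-local cut sits at ONE MEAN FREE PATH ℓ, not at a fixed
multiple of the collision duration; N ≥ N₀ replaces 'uniformly in N'; the Stosszahlansatz clause
holds IN THE MEAN over pasts, not for every past; the reference law is FLUX-weighted). Typed member
= the EQUILIBRIUM (stationary) case the original named as its first instance; the
evolved-local-Gibbs version (reference = flux-weighted local Maxwellian of the system's own fields)
is the intended layer-2 use and stays informal. SETTING: d ≥ d₀ (d₀ ≥ 4), N+1 spheres of diameter ε
= σ(N+1)^(−1/d) on 𝕋^d under the equilibrium Gibbs law P (canonicalDensity of M_{1,0,1}, tagged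
sphere i₀ = 0), reduced density η = σ^d < η₀(d), V_{d−1} = |B^{d−1}|, mean free path ℓ =
ε/(V_{d−1}η) = K_d·ε, mean free time τ = ℓ/⟨|v−v*|⟩ with ⟨|v−v*|⟩ = 2Γ((d+1)/2)/Γ(d/2), window [0,
sτ] (s ≥ 1 mean free times). CLAIM: ∃ absolute C, ∃ d₀ ∀ d ≥ d₀ ∃ η₀ ∀ σ (σ^d < η₀) ∀ s ≥ 1 ∀ n ∃ N₀
∀ N ≥ N₀ ∀ flows Φ: (a′) DISTANT RECOLLISIONS — P{∃ partner j -/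
@[route_item "route-AtomisticToContinuum-DimensionLadder"]
def FreshPartnerStatisticsR : Prop :=
  ∃ C : ℝ, 0 < C ∧ ∃ d₀ : ℕ, 4 ≤ d₀ ∧ ∀ d : ℕ, d₀ ≤ d → ∃ η₀ : ℝ, 0 < η₀ ∧ ∀ σ : ℝ, 0 < σ → σ ^ d < η₀ → ∀ s : ℝ, 1 ≤ s → ∀ n : ℕ, ∃ N₀ : ℕ, ∀ N : ℕ, N₀ ≤ N → ∀ Φ : Literature.Analysis.FluidPDE.HardSphereFlow (Literature.Analysis.FluidPDE.Torus.geometry (Fin d)) (σ * ((N + 1 : ℕ) : ℝ) ^ (-(1 / (d : ℝ)))) (N + 1), let E := EuclideanSpace ℝ (Fin d); let G := Literature.Analysis.FluidPDE.Torus.geometry (Fin d); let ε := σ * ((N + 1 : ℕ) : ℝ) ^ (-(1 / (d : ℝ))); let η := σ ^ d; let Vd1 := (volume (Metric.ball (0 : EuclideanSpace ℝ (Fin (d - 1))) 1)).toReal; let ℓ := ε / (Vd1 * η); let vrel := 2 * Real.Gamma (((d : ℝ) + 1) / 2) / Real.Gamma ((d : ℝ) / 2); let τ := ℓ / vrel;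 let f₀ := fun y : UnitAddTorus (Fin d) × E => Literature.Analysis.FluidPDE.localMaxwellian 1 1 (0 : E) y.2; let P := Literature.Analysis.FluidPDE.particleLaw Φ (Literature.Analysis.FluidPDE.canonicalDensity G ε (N + 1) f₀); let i₀ : Fin (N + 1) := 0; let Coll := fun (z : Literature.Analysis.FluidPDE.Config (N + 1) (Fin d) (UnitAddTorus (Fin d))) (j : Fin (N + 1)) (t : ℝ) => Literature.Analysis.FluidPDE.Collide G ε (Φ.flow t z) i₀ j; let sep := fun (z : Literature.Analysis.FluidPDE.Config (N + 1) (Fin d) (UnitAddTorus (Fin d))) (j : Fin (N + 1)) (t : ℝ) => ‖G.sepVec (Φ.flow t z i₀).1 (Φ.flow t z j).1‖; let Distant : Set (Literature.Analysis.FluidPDE.Config (N + 1) (Fin d) (UnitAddTorus (Fin d))) := {z | ∃ j, j ≠ i₀ ∧ ∃ t₁ t₂ : ℝ, t₁ < t₂ ∧ t₂ ∈ Icc 0 (s * τ) ∧ t₂ - t₁ ≤ s * τ ∧ Coll z j t₁ ∧ Coll z j t₂ ∧ ∃ t' ∈ Ioo t₁ t₂, ℓ ≤ sep z j t'}; let LocalCount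 := fun (z : Literature.Analysis.FluidPDE.Config (N + 1) (Fin d) (UnitAddTorus (Fin d))) => Set.ncard {t₂ : ℝ | t₂ ∈ Icc 0 (s * τ) ∧ ∃ j, j ≠ i₀ ∧ Coll z j t₂ ∧ ∃ t₁ : ℝ, t₁ < t₂ ∧ t₂ - t₁ ≤ s * τ ∧ Coll z j t₁ ∧ ∀ t' ∈ Ioo t₁ t₂, sep z j t' < ℓ}; let rec_ := fun (k : ℕ) (z : Literature.Analysis.FluidPDE.Config (N + 1) (Fin d) (UnitAddTorus (Fin d))) => Φ.nthRecordOf i₀ k z; let X := fun (z : Literature.Analysis.FluidPDE.Config (N + 1) (Fin d) (UnitAddTorus (Fin d))) => ((z i₀, fun k : Fin n => ((rec_ k z).time, (rec_ k z).impactVec, (rec_ k z).preVel, (rec_ k z).postVel)), (rec_ n z).time); let Y := fun (z : Literature.Analysis.FluidPDE.Config (N + 1) (Fin d) (UnitAddTorus (Fin d))) => ((rec_ n z).impactVec, (rec_ n z).preVel.2); let vtag := fun (z : Literature.Analysis.FluidPDE.Config (N + 1) (Fin d) (UnitAddTorus (Fin d))) => (rec_ n z).preVel.1; let En : Set (Literature.Analysis.FluidPDE.Config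 (N + 1) (Fin d) (UnitAddTorus (Fin d))) := {z | n + 1 ≤ Set.ncard (Literature.Analysis.FluidPDE.collisionTimesOf G ε (fun t => Φ.flow t z) i₀ ∩ Ioc 0 (s * τ))}; let m := fun (v : E) => (((Literature.MathematicalPhysics.KineticTheory.sphereMeasure (E := E)).map Subtype.val).prod (volume : Measure E)).withDensity (fun p : E × E => ENNReal.ofReal (max (inner ℝ (p.2 - v) p.1) 0 * Literature.Analysis.FluidPDE.globalMaxwellian p.2)); let μref := fun (v : E) => (m v Set.univ)⁻¹ • m v; P Distant ≤ ENNReal.ofReal (C ^ d * s * (Vd1 * η) ^ (d - 1)) ∧ (∃ F : Literature.Analysis.FluidPDE.Config (N + 1) (Fin d) (UnitAddTorus (Fin d)) → ENNReal, Measurable F ∧ (∀ z, (LocalCount z : ENNReal) ≤ F z) ∧ ∫⁻ z, F z ∂P ≤ ENNReal.ofReal (C * s * (Vd1 * η))) ∧ ∀ g : (((UnitAddTorus (Fin d) × E) × (Fin n → ℝ × E × (E × E) × (E × E))) × ℝ) × (E × E) → ℝ, Measurable g → (∀ p, |g p| ≤ 1) → |∫ z in En, (g (X z, Y z) - ∫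 y, g (X z, y) ∂(μref (vtag z))) ∂P| ≤ C * (Vd1 * η + d * (Vd1 * η) ^ (d - 1))

/-- item stmt-AtomisticToContinuum-18864 · crux · rank 5 · open · by planner
why it might fail: At d = 3 it is Spohn's local-equilibrium property (3.22) for deterministic hard spheres at fixed reduced density over ≍N^{1/3} collision times — nothing in print; undamped conserved-mode pair correlations (Cohen1967 §4c–d rings) may spoil the weighted-L¹ one-body Maxwellian closure even when dilute.
sources: Spohn1991, Cohen1967, OllaVaradhanYau1993, ElskensFrisch1988, PulvirentiSimonella2016
[crux] ENGINE HALF 1 — IDENTIFICATION OF THE ONE-BODY LAW (child of the glued split of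
AllDimensionEuler 9342, strategist cstrat-9342-r1, 2026-08-17; registered skeleton
Cruxes/AllDimensionEuler/Lines/EngineHalves.lean stub_oneBodyMaxwellian): for every d ≥ 3 there is
η₀(d) > 0 such that for all continuous positive profiles there is σ₀ with: for 0 < σ < σ₀, every
classical d-dimensional hard-sphere Euler solution on [0,T) (IsHardSphereEulerSolutionDim) whose
packing stays below η₀, and every family of hard-sphere flows of N+1 spheres of diameter
hsDiameterDim d σ N, if the empirical fields converge in probability at t = 0 under the local Gibbs
laws (TendstoHydroFieldsAtDim … 0) then for every t < T the ONE-particle marginal of the time-t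
density 1_D·(canonical local-Gibbs density ∘ Φ_N(−t)) converges in (1+|v|²)²-weighted L¹ to the
local Maxwellian ρ_t(x)M_{1,u_t(x),θ_t(x)}(v) of the Euler solution (= localGibbsProfileDim d (ρ t)
(u t) (θ t)). It is the first conjunct of the joint engine LocalEquilibriumAllDim (9344) under its
own thresholds (oneBodyMaxwellianAllDim_of_engine). INCOMPARABLE with the conjunct: convergence of
the one-body law gives convergence of the MEAN of each emp -/
@[route_item "route-AtomisticToContinuum-DimensionLadder"]
def OneBodyMaxwellianAllDim : Prop :=
  ∀ d : ℕ, 3 ≤ d → ∃ η₀ : ℝ, 0 < η₀ ∧ ∀ (a₀ θ₀ : UnitAddTorus (Fin d) → ℝ) (u₀ : UnitAddTorus (Fin d) → EuclideanSpace ℝ (Fin d)), Continuous a₀ → Continuous θ₀ → Continuous u₀ → (∀ x, 0 < a₀ x) → (∀ x, 0 < θ₀ x) → ∃ σ₀ : ℝ, 0 < σ₀ ∧ ∀ σ : ℝ, 0 < σ → σ < σ₀ → ∀ (T : ℝ) (ρ θ : ℝ → UnitAddTorus (Fin d) → ℝ) (u : ℝ → UnitAddTorus (Fin d) → EuclideanSpace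 ℝ (Fin d)), Literature.MathematicalPhysics.KineticTheory.IsHardSphereEulerSolutionDim d σ T ρ u θ → (∀ t ∈ Set.Ico 0 T, ∀ x, ρ t x * σ ^ d < η₀) → ∀ Φ : (N : ℕ) → Literature.Analysis.FluidPDE.HardSphereFlow (Literature.Analysis.FluidPDE.Torus.geometry (Fin d)) (Literature.MathematicalPhysics.KineticTheory.hsDiameterDim d σ N) (N + 1), Literature.MathematicalPhysics.KineticTheory.TendstoHydroFieldsAtDim d (fun N => Literature.MathematicalPhysics.KineticTheory.localGibbsLawDim d σ a₀ u₀ θ₀ N (Φ N)) Φ ρ u θ 0 → ∀ t ∈ Set.Ico 0 T, Filter.Tendsto (fun N : ℕ => ∫⁻ y : UnitAddTorus (Fin d) × EuclideanSpace ℝ (Fin d), ENNReal.ofReal ((1 + ‖y.2‖ ^ 2) ^ 2 * |Literature.Analysis.FluidPDE.nthMarginal (N + 1) 1 ((Literature.Analysis.FluidPDE.hardSphereDomain (Literature.Analysis.FluidPDE.Torus.geometry (Fin d)) (N + 1) (Literature.MathematicalPhysics.KineticTheory.hsDiameterDim d σ N)).indicator (Literature.Analysis.FluidPDE.hsTransport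 (Φ N) t (Literature.Analysis.FluidPDE.canonicalDensity (Literature.Analysis.FluidPDE.Torus.geometry (Fin d)) (Literature.MathematicalPhysics.KineticTheory.hsDiameterDim d σ N) (N + 1) (Literature.MathematicalPhysics.KineticTheory.localGibbsProfileDim d a₀ u₀ θ₀)))) (fun _ => y) - Literature.MathematicalPhysics.KineticTheory.localGibbsProfileDim d (ρ t) (u t) (θ t) y|)) Filter.atTop (nhds 0)

/-- item stmt-AtomisticToContinuum-18871 · crux · rank 6 · open · by planner
why it might fail: Chaos propagation at FIXED reduced density over macroscopic times (≍N^{1/d} collisions per particle) is open in every d: Lanford1975/GST2013/BGSSAnnals2023 give finite kinetic windows under Boltzmann–Grad scaling only; long-range hydrodynamic pair correlations may defeat weighted-L¹ factorisation.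
sources: Sznitman1991, Lanford1975, GST2013, BGSSAnnals2023, PulvirentiSimonella2016, Spohn1991
[crux] ENGINE HALF 2 — ASYMPTOTIC PAIR FACTORISATION (child of the glued split of AllDimensionEuler
9342, strategist cstrat-9342-r1, 2026-08-17; registered stub stub_pairFactorisation): same prefix as
OneBodyMaxwellianAllDim (every d ≥ 3, η₀(d), profiles, σ < σ₀, guarded classical d-dim hard-sphere
Euler solution, hard-sphere flow family, LLN of the fields at t = 0); conclusion: for every t < T
the TWO-particle marginal of the time-t density minus the product of its one-particle marginals
tends to 0 in (1+|v|²)(1+|v′|²)-weighted L¹ (propagation of chaos at fixed reduced density, relative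
to nothing: it identifies no limit). Second conjunct of the joint engine LocalEquilibriumAllDim
(9344) under its own thresholds (pairFactorisationAllDim_of_engine). INCOMPARABLE with the conjunct:
pair independence identifies no limit fields, and the conjunct's field LLN only yields decorrelation
of POSITION pairs tested against χ⊗χ, not phase-space weighted-L¹ factorisation; with
OneBodyMaxwellianAllDim + 9346 + 9345 it gives AllDimensionEuler via the proved glue. [difficulty:
open-problem] why it might fail: Chaos propagation at FIXED reduced density over macroscopic times
(≍N^{1/d} collisions pe -/
@[route_item "route-AtomisticToContinuum-DimensionLadder"]
def PairFactorisationAllDim : Prop :=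
  ∀ d : ℕ, 3 ≤ d → ∃ η₀ : ℝ, 0 < η₀ ∧ ∀ (a₀ θ₀ : UnitAddTorus (Fin d) → ℝ) (u₀ : UnitAddTorus (Fin d) → EuclideanSpace ℝ (Fin d)), Continuous a₀ → Continuous θ₀ → Continuous u₀ → (∀ x, 0 < a₀ x) → (∀ x, 0 < θ₀ x) → ∃ σ₀ : ℝ, 0 < σ₀ ∧ ∀ σ : ℝ, 0 < σ → σ < σ₀ → ∀ (T : ℝ) (ρ θ : ℝ → UnitAddTorus (Fin d) → ℝ) (u : ℝ → UnitAddTorus (Fin d) → EuclideanSpace ℝ (Fin d)), Literature.MathematicalPhysics.KineticTheory.IsHardSphereEulerSolutionDim d σ T ρ u θ → (∀ t ∈ Set.Ico 0 T, ∀ x, ρ t x * σ ^ d < η₀) → ∀ Φ : (N : ℕ) → Literature.Analysis.FluidPDE.HardSphereFlow (Literature.Analysis.FluidPDE.Torus.geometry (Fin d)) (Literature.MathematicalPhysics.KineticTheory.hsDiameterDim d σ N) (N + 1), Literature.MathematicalPhysics.KineticTheory.TendstoHydroFieldsAtDim d (fun N => Literature.MathematicalPhysics.KineticTheory.localGibbsLawDim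 d σ a₀ u₀ θ₀ N (Φ N)) Φ ρ u θ 0 → ∀ t ∈ Set.Ico 0 T, Filter.Tendsto (fun N : ℕ => ∫⁻ p : (UnitAddTorus (Fin d) × EuclideanSpace ℝ (Fin d)) × (UnitAddTorus (Fin d) × EuclideanSpace ℝ (Fin d)), ENNReal.ofReal ((1 + ‖p.1.2‖ ^ 2) * (1 + ‖p.2.2‖ ^ 2) * |Literature.Analysis.FluidPDE.nthMarginal (N + 1) 2 ((Literature.Analysis.FluidPDE.hardSphereDomain (Literature.Analysis.FluidPDE.Torus.geometry (Fin d)) (N + 1) (Literature.MathematicalPhysics.KineticTheory.hsDiameterDim d σ N)).indicator (Literature.Analysis.FluidPDE.hsTransport (Φ N) t (Literature.Analysis.FluidPDE.canonicalDensity (Literature.Analysis.FluidPDE.Torus.geometry (Fin d)) (Literature.MathematicalPhysics.KineticTheory.hsDiameterDim d σ N) (N + 1) (Literature.MathematicalPhysics.KineticTheory.localGibbsProfileDim d a₀ u₀ θ₀)))) ![p.1, p.2] - Literature.Analysis.FluidPDE.nthMarginal (N + 1) 1 ((Literature.Analysis.FluidPDE.hardSphereDomain (Literature.Analysis.FluidPDE.Torus.geometry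 (Fin d)) (N + 1) (Literature.MathematicalPhysics.KineticTheory.hsDiameterDim d σ N)).indicator (Literature.Analysis.FluidPDE.hsTransport (Φ N) t (Literature.Analysis.FluidPDE.canonicalDensity (Literature.Analysis.FluidPDE.Torus.geometry (Fin d)) (Literature.MathematicalPhysics.KineticTheory.hsDiameterDim d σ N) (N + 1) (Literature.MathematicalPhysics.KineticTheory.localGibbsProfileDim d a₀ u₀ θ₀)))) ![p.1] * Literature.Analysis.FluidPDE.nthMarginal (N + 1) 1 ((Literature.Analysis.FluidPDE.hardSphereDomain (Literature.Analysis.FluidPDE.Torus.geometry (Fin d)) (N + 1) (Literature.MathematicalPhysics.KineticTheory.hsDiameterDim d σ N)).indicator (Literature.Analysis.FluidPDE.hsTransport (Φ N) t (Literature.Analysis.FluidPDE.canonicalDensity (Literature.Analysis.FluidPDE.Torus.geometry (Fin d)) (Literature.MathematicalPhysics.KineticTheory.hsDiameterDim d σ N) (N + 1) (Literature.MathematicalPhysics.KineticTheory.localGibbsProfileDim d a₀ u₀ θ₀)))) ![p.2]|)) Filter.atTop (nhds 0)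

/-- item stmt-AtomisticToContinuum-9345 · support · rank 9 · open · by planner
sources: Sznitman1991, GST2013, Spohn1991
[support] d-generic MARGINALS ⇒ FIELDS (Sznitman-type variance computation + Chebyshev, the d-dim
twin of DenseKineticExpansion's MarginalsToL2 0806 pushed to the in-probability form): for d ≥ 3, σ
> 0, continuous profiles, continuous (ρ_t,u_t,θ_t) with θ_t > 0, flows Φ and t: if the time-t
density W_N(t) is a.e. permutation-symmetric for every N, its 1-marginal → ρ_tM_(u_t,θ_t) in
(1+|v|²)²-weighted L¹ and its 2-marginal − product → 0 in weighted L¹, then the empirical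
density/momentum/energy fields at time t converge in probability to (ρ_t, ρ_tu_t, ρ_t(|u_t|²/2 +
dθ_t/2)) tested against every continuous χ. [difficulty: provable-now] -/
@[route_item "route-AtomisticToContinuum-DimensionLadder"]
def MarginalsToFieldsAllDim : Prop :=
  ∀ d : ℕ, 3 ≤ d → ∀ (σ : ℝ) (a₀ θ₀ : UnitAddTorus (Fin d) → ℝ) (u₀ : UnitAddTorus (Fin d) → EuclideanSpace ℝ (Fin d)), let G := Literature.Analysis.FluidPDE.Torus.geometry (Fin d); let ε := fun N : ℕ => σ * ((N + 1 : ℕ) : ℝ) ^ (-(1 / (d : ℝ))); let f₀ := fun y : UnitAddTorus (Fin d) × EuclideanSpace ℝ (Fin d) => a₀ y.1 * Literature.Analysis.FluidPDE.localMaxwellian 1 (θ₀ y.1) (u₀ y.1) y.2; ∀ (ρ θ : ℝ → UnitAddTorus (Fin d) → ℝ) (u : ℝ → UnitAddTorus (Fin d) → EuclideanSpace ℝ (Fin d)) (Φ : (N : ℕ) → Literature.Analysis.FluidPDE.HardSphereFlow G (ε N) (N + 1)) (t : ℝ), 0 < σ → Continuous a₀ → Continuous θ₀ → Continuous u₀ →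 (∀ x, 0 < a₀ x) → (∀ x, 0 < θ₀ x) → Continuous (ρ t) → Continuous (u t) → Continuous (θ t) → (∀ x, 0 < θ t x) → let E := fun (r : ℝ) (w : EuclideanSpace ℝ (Fin d)) (ϑ : ℝ) => r * (‖w‖ ^ 2 / 2 + (d : ℝ) / 2 * ϑ); let L := fun N : ℕ => Literature.Analysis.FluidPDE.particleLaw (Φ N) (Literature.Analysis.FluidPDE.canonicalDensity G (ε N) (N + 1) f₀); let W := fun N : ℕ => (Literature.Analysis.FluidPDE.hardSphereDomain G (N + 1) (ε N)).indicator (Literature.Analysis.FluidPDE.hsTransport (Φ N) t (Literature.Analysis.FluidPDE.canonicalDensity G (ε N) (N + 1) f₀)); let g := fun y : UnitAddTorus (Fin d) × EuclideanSpace ℝ (Fin d) => ρ t y.1 * Literature.Analysis.FluidPDE.localMaxwellian 1 (θ t y.1) (u t y.1) y.2; (∀ (N : ℕ) (π : Equiv.Perm (Fin (N + 1))), EventuallyEq (ae volume) (fun z => W N (z ∘ π)) (W N)) → Tendsto (fun N : ℕ => ∫⁻ y : UnitAddTorus (Fin d) × EuclideanSpace ℝ (Fin d), ENNReal.ofReal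 ((1 + ‖y.2‖ ^ 2) ^ 2 * |Literature.Analysis.FluidPDE.nthMarginal (N + 1) 1 (W N) (fun _ => y) - g y|)) atTop (nhds 0) → Tendsto (fun N : ℕ => ∫⁻ p : (UnitAddTorus (Fin d) × EuclideanSpace ℝ (Fin d)) × (UnitAddTorus (Fin d) × EuclideanSpace ℝ (Fin d)), ENNReal.ofReal ((1 + ‖p.1.2‖ ^ 2) * (1 + ‖p.2.2‖ ^ 2) * |Literature.Analysis.FluidPDE.nthMarginal (N + 1) 2 (W N) ![p.1, p.2] - Literature.Analysis.FluidPDE.nthMarginal (N + 1) 1 (W N) ![p.1] * Literature.Analysis.FluidPDE.nthMarginal (N + 1) 1 (W N) ![p.2]|)) atTop (nhds 0) → ∀ χ : UnitAddTorus (Fin d) → ℝ, Continuous χ → ∀ δ > (0 : ℝ), Tendsto (fun N => L N {z | δ < |(∫ y, χ y.1 ∂Literature.Analysis.FluidPDE.empiricalMeasure ((Φ N).flow t z)) - ∫ x, χ x * ρ t x|}) atTop (nhds 0) ∧ Tendsto (fun N => L N {z | δ < ‖(∫ y, χ y.1 • y.2 ∂Literature.Analysis.FluidPDE.empiricalMeasure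 ((Φ N).flow t z)) - ∫ x, (χ x * ρ t x) • u t x‖}) atTop (nhds 0) ∧ Tendsto (fun N => L N {z | δ < |(∫ y, χ y.1 * (‖y.2‖ ^ 2 / 2) ∂Literature.Analysis.FluidPDE.empiricalMeasure ((Φ N).flow t z)) - ∫ x, χ x * E (ρ t x) (u t x) (θ t x)|}) atTop (nhds 0)

/-- item stmt-AtomisticToContinuum-9346 · support · rank 9 · open · by planner
sources: GST2013, Alexander1975, CIP1994
[support] RELABELLING SYMMETRY: for d ≥ 3, σ > 0, profiles, any family of hard-sphere flows, t, N
and any permutation π of the N+1 labels, the time-t density 1_D·(canonical local Gibbs density ∘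
Φ_N(−t)) is a.e. invariant under z ↦ z∘π (canonical density and hard-sphere domain are symmetric; a
relabelled hard-sphere trajectory is a hard-sphere trajectory, so by
IsHardSphereTrajectory.unique_holds / HardSphereFlow.flow_eq_ae_holds the flow commutes with
relabelling off a null set). Discharges the symmetry hypothesis of MarginalsToFieldsAllDim for every
HardSphereFlow (the structure carries no equivariance field). [difficulty: provable-now] -/
@[route_item "route-AtomisticToContinuum-DimensionLadder"]
def FlowRelabelSymmetry : Prop :=
  ∀ d : ℕ, 3 ≤ d → ∀ (σ : ℝ) (a₀ θ₀ : UnitAddTorus (Fin d) → ℝ) (u₀ : UnitAddTorus (Fin d) → EuclideanSpace ℝ (Fin d)), let G := Literature.Analysis.FluidPDE.Torus.geometry (Fin d); let ε := fun N : ℕ => σ * ((N + 1 : ℕ) : ℝ) ^ (-(1 / (d : ℝ))); let f₀ := fun y : UnitAddTorus (Fin d) × EuclideanSpace ℝ (Fin d) => a₀ y.1 * Literature.Analysis.FluidPDE.localMaxwellian 1 (θ₀ y.1) (u₀ y.1) y.2; ∀ (Φ : (N : ℕ) → Literature.Analysis.FluidPDE.HardSphereFlow G (ε N) (N + 1)) (t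 : ℝ) (N : ℕ) (π : Equiv.Perm (Fin (N + 1))), 0 < σ → EventuallyEq (ae volume) (fun z => (Literature.Analysis.FluidPDE.hardSphereDomain G (N + 1) (ε N)).indicator (Literature.Analysis.FluidPDE.hsTransport (Φ N) t (Literature.Analysis.FluidPDE.canonicalDensity G (ε N) (N + 1) f₀)) (z ∘ π)) ((Literature.Analysis.FluidPDE.hardSphereDomain G (N + 1) (ε N)).indicator (Literature.Analysis.FluidPDE.hsTransport (Φ N) t (Literature.Analysis.FluidPDE.canonicalDensity G (ε N) (N + 1) f₀)))

/-- item stmt-AtomisticToContinuum-9347 · support · rank 9 · open · by planner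
sources: ElskensFrisch1988, AgoritsasMaimbourgZamponi2019, CIP1994
[support] GENTLE KICKS (mechanism (ii), elementary): under the hard-sphere cross-section law in
dimension d (impact parameter b uniform on the unit (d−1)-ball, deflection angle of the relative
velocity χ = 2 arccos|b|) the mean-square deflection is at most π²/d: ∫_(|b|<1) (2 arccos|b|)² db ≤
(π²/d)·vol(B^(d−1)) for every d ≥ 2 (proof: 4 arccos² r ≤ π²(1−r) on [0,1] by concavity, and
E[1−|b|] = 1/d under the rim law (d−1)r^(d−2)dr; numerically LHS/vol ≈ 8/d). Records the
quantitative grazing dominance used by the engine at the top rung. [difficulty: provable-now] -/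
@[route_item "route-AtomisticToContinuum-DimensionLadder"]
def GrazingDeflectionMoment : Prop :=
  ∀ d : ℕ, 2 ≤ d → ∫ b in Metric.ball (0 : EuclideanSpace ℝ (Fin (d - 1))) 1, (2 * Real.arccos ‖b‖) ^ 2 ≤ Real.pi ^ 2 / d * (volume (Metric.ball (0 : EuclideanSpace ℝ (Fin (d - 1))) 1)).toReal

/-- item stmt-AtomisticToContinuum-9348 · support · rank 9 · open · by planner
sources: Spohn1991, Literature.MathematicalPhysics.KineticTheory.HydrodynamicLimit (HardSphereEuler.lean)
[support] d = 3 SPECIALISATION: the d = 3 member of the inlined d-generic guarded statement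
(UnitAddTorus (Fin 3), exponent 1/↑3, energy ρ(|u|²/2 + ↑3/2·θ), pressure ρθ(1 + η f_ex′(η)) from
the d = 3 free volume) implies HydroLimitInBand exactly as typed in route ImplosionLoophole (stmt
3093: library hsDiameter, localGibbsLaw, IsHardSphereEulerSolution, TendstoHydroFieldsAt,
totalEnergyDensity, hsPressure). Pure unfolding plus Nat.cast bookkeeping ((3:ℕ):ℝ) = 3 (the three
defining identities are checked by `simp` in the planner's Sketch.lean). [difficulty: provable-now] -/
@[route_item "route-AtomisticToContinuum-DimensionLadder"]
def DimThreeGlue : Prop :=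
  (∃ η₀ : ℝ, 0 < η₀ ∧ ∀ (a₀ θ₀ : UnitAddTorus (Fin 3) → ℝ) (u₀ : UnitAddTorus (Fin 3) → EuclideanSpace ℝ (Fin 3)), Continuous a₀ → Continuous θ₀ → Continuous u₀ → (∀ x, 0 < a₀ x) → (∀ x, 0 < θ₀ x) → ∃ σ₀ : ℝ, 0 < σ₀ ∧ ∀ σ : ℝ, 0 < σ → σ < σ₀ → let G := Literature.Analysis.FluidPDE.Torus.geometry (Fin 3); let ε := fun N : ℕ => σ * ((N + 1 : ℕ) : ℝ) ^ (-(1 / ((3 : ℕ) : ℝ))); let f₀ := fun y : UnitAddTorus (Fin 3) × EuclideanSpace ℝ (Fin 3) => a₀ y.1 * Literature.Analysis.FluidPDE.localMaxwellian 1 (θ₀ y.1) (u₀ y.1) y.2; ∀ (T : ℝ) (ρ θ : ℝ → UnitAddTorus (Fin 3) → ℝ) (u : ℝ → UnitAddTorus (Fin 3) → EuclideanSpace ℝ (Fin 3)), let Z := fun η : ℝ => 1 + η * deriv (fun η' : ℝ => limsup (fun n : ℕ => -(n : ℝ)⁻¹ * Real.log (volume {q : Fin n → UnitAddTorus (Fin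 3) | ∀ i j, i ≠ j → (η' / n) ^ (1 / ((3 : ℕ) : ℝ)) < Literature.Analysis.FluidPDE.Torus.euclidDist (q i) (q j)}).toReal) atTop) η; let P := fun r ϑ : ℝ => r * ϑ * Z (r * σ ^ 3); let E := fun (r : ℝ) (w : EuclideanSpace ℝ (Fin 3)) (ϑ : ℝ) => r * (‖w‖ ^ 2 / 2 + ((3 : ℕ) : ℝ) / 2 * ϑ); Literature.Analysis.FunctionSpaces.Torus.IsSmoothSpaceTimeOn (Ico 0 T) ρ → Literature.Analysis.FunctionSpaces.Torus.IsSmoothSpaceTimeOn (Ico 0 T) u → Literature.Analysis.FunctionSpaces.Torus.IsSmoothSpaceTimeOn (Ico 0 T) θ → (∀ t ∈ Ico 0 T, ∀ x, 0 < ρ t x) → (∀ t ∈ Ico 0 T, ∀ x, 0 < θ t x) → (∀ t ∈ Ico 0 T, ∀ x, Literature.Analysis.FunctionSpaces.Torus.timeDerivWithin (Ico 0 T) ρ t x + Literature.Analysis.FunctionSpaces.Torus.divergence (fun y => ρ t y • u t y) x = 0) → (∀ t ∈ Ico 0 T, ∀ x, Literature.Analysis.FunctionSpaces.Torus.timeDerivWithin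 (Ico 0 T) (fun s y => ρ s y • u s y) t x + (∑ i, Literature.Analysis.FunctionSpaces.Torus.partialDeriv i (fun y => (ρ t y * u t y i) • u t y) x) + Literature.Analysis.FunctionSpaces.Torus.gradient (fun y => P (ρ t y) (θ t y)) x = 0) → (∀ t ∈ Ico 0 T, ∀ x, Literature.Analysis.FunctionSpaces.Torus.timeDerivWithin (Ico 0 T) (fun s y => E (ρ s y) (u s y) (θ s y)) t x + Literature.Analysis.FunctionSpaces.Torus.divergence (fun y => (E (ρ t y) (u t y) (θ t y) + P (ρ t y) (θ t y)) • u t y) x = 0) → (∀ t ∈ Ico 0 T, ∀ x, ρ t x * σ ^ 3 < η₀) → ∀ Φ : (N : ℕ) → Literature.Analysis.FluidPDE.HardSphereFlow G (ε N) (N + 1), let L := fun N : ℕ => Literature.Analysis.FluidPDE.particleLaw (Φ N) (Literature.Analysis.FluidPDE.canonicalDensity G (ε N) (N + 1) f₀); let Tend := fun t : ℝ => ∀ χ : UnitAddTorus (Fin 3) → ℝ, Continuous χ → ∀ δ > (0 : ℝ), Tendsto (fun N => L N {z | δ < |(∫ y, χ y.1 ∂Literature.Analysis.FluidPDE.empiricalMeasure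 ((Φ N).flow t z)) - ∫ x, χ x * ρ t x|}) atTop (nhds 0) ∧ Tendsto (fun N => L N {z | δ < ‖(∫ y, χ y.1 • y.2 ∂Literature.Analysis.FluidPDE.empiricalMeasure ((Φ N).flow t z)) - ∫ x, (χ x * ρ t x) • u t x‖}) atTop (nhds 0) ∧ Tendsto (fun N => L N {z | δ < |(∫ y, χ y.1 * (‖y.2‖ ^ 2 / 2) ∂Literature.Analysis.FluidPDE.empiricalMeasure ((Φ N).flow t z)) - ∫ x, χ x * E (ρ t x) (u t x) (θ t x)|}) atTop (nhds 0); Tend 0 → ∀ t ∈ Ico 0 T, Tend t) → (∃ η₀ : ℝ, 0 < η₀ ∧ ∀ (a₀ θ₀ : UnitAddTorus (Fin 3) → ℝ) (u₀ : UnitAddTorus (Fin 3) → EuclideanSpace ℝ (Fin 3)), Continuous a₀ → Continuous θ₀ → Continuous u₀ → (∀ x, 0 < a₀ x) → (∀ x, 0 < θ₀ x) → ∃ σ₀ : ℝ, 0 < σ₀ ∧ ∀ σ : ℝ, 0 < σ → σ < σ₀ → ∀ (T : ℝ) (ρ θ : ℝ → UnitAddTorus (Fin 3) → ℝ) (u :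 ℝ → UnitAddTorus (Fin 3) → EuclideanSpace ℝ (Fin 3)), Literature.MathematicalPhysics.KineticTheory.IsHardSphereEulerSolution σ T ρ u θ → (∀ t ∈ Ico 0 T, ∀ x, ρ t x * σ ^ 3 < η₀) → ∀ Φ : (N : ℕ) → Literature.Analysis.FluidPDE.HardSphereFlow (Literature.Analysis.FluidPDE.Torus.geometry (Fin 3)) (Literature.MathematicalPhysics.KineticTheory.hsDiameter σ N) (N + 1), Literature.MathematicalPhysics.KineticTheory.TendstoHydroFieldsAt (fun N => Literature.MathematicalPhysics.KineticTheory.localGibbsLaw σ a₀ u₀ θ₀ N (Φ N)) Φ ρ u θ 0 → ∀ t ∈ Ico 0 T, Literature.MathematicalPhysics.KineticTheory.TendstoHydroFieldsAt (fun N => Literature.MathematicalPhysics.KineticTheory.localGibbsLaw σ a₀ u₀ θ₀ N (Φ N)) Φ ρ u θ t)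

/-- item stmt-AtomisticToContinuum-14524 · support · rank 10 · open · by planner
sources: Spohn1991, Sznitman1991, GST2013
[support] GLUE cruxes → target (route-choice (a) for the gate stamp route.target-unreachable,
operator hold 2026-08-16T02:51Z; supersedes the first filing stmt-AtomisticToContinuum-14165 =
AllDimOfEngine, which the gate blocked as `missing decl` only because rank-9 supports render in id
order and put that decl before the two support decls it names — hence rank 10 here, and the
hypotheses listed engine → symmetry → marginals): the d-uniform engine LocalEquilibriumAllDim
(1-marginal → local Maxwellian of the Euler solution, 2-marginal factorises), the relabelling
symmetry FlowRelabelSymmetry (discharges the exchangeability hypothesis) and the d-generic marginals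
⇒ fields step MarginalsToFieldsAllDim together give the target X = AllDimensionEuler for every d ≥ 3
with the engine's own η₀(d) and σ₀ — pure bookkeeping plus slice continuity of smooth space–time
fields (IsSmoothSpaceTimeOn.isSmooth_slice / IsSmooth.continuous) feeding the continuity hypotheses
of MarginalsToFieldsAllDim. Provable now: the proof is the hAll block of the rev-4 deciding theorem
with `intro hL hS hM` (theorem engineToAllDim_holds in the planner's Sketch.lean, lean check rc 0,
axioms propext/Classical.choice/Qu -/
@[route_item "route-AtomisticToContinuum-DimensionLadder"]
def EngineToAllDim : Prop :=
  LocalEquilibriumAllDim → FlowRelabelSymmetry → MarginalsToFieldsAllDim → AllDimensionEuler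

/-- item stmt-AtomisticToContinuum-18943 · support · rank 10 · open · by planner
[support] GLUE of the split AllDimensionEuler ⇐ OneBodyMaxwellianAllDim, PairFactorisationAllDim,
FlowRelabelSymmetry, MarginalsToFieldsAllDim (strategist cstrat-9342-r1, 2026-08-17; PROVABLE NOW —
proof kernel-checked and registered: Cruxes/AllDimensionEuler/Lines/EngineHalves.lean
(forall_hydroLimitInBandDim_of_halves + allDimensionEuler_iff_forall_hydroLimitInBandDim;
composition AllDimensionEuler_of, axioms propext/Classical.choice/Quot.sound) and the Theorems
candidate DimensionLadderAllDimensionEulerSplit.lean (AllDimensionEuler_of_subs) attached as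
evidence on stmt-9342): for each d ≥ 3 take η₀ := min η₁ η₂ and σ₀ := min σ₁ σ₂ of the two halves,
derive the two guards from ρσ^d < η₀, get the two marginal convergences at t, continuity of ρ_t,
u_t, θ_t from joint smoothness (IsSmoothSpaceTimeOn.isSmooth_slice, IsSmooth.continuous), θ_t > 0
from the solution class, exchangeability from FlowRelabelSymmetry, apply MarginalsToFieldsAllDim,
and transport the Literature form ∀ d ≥ 3, HydroLimitInBandDim d to the inlined decl by
hydroLimitInBandDim_iff. [difficulty: provable-now] [Sznitman1991, Spohn1991] -/
@[route_item "route-AtomisticToContinuum-DimensionLadder"]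
def AllDimensionEulerOfHalves : Prop :=
  OneBodyMaxwellianAllDim → PairFactorisationAllDim → FlowRelabelSymmetry → MarginalsToFieldsAllDim → AllDimensionEuler

-- earlier Assembly (stmt-AtomisticToContinuum-9349, replaced 2026-08-16T23:14:22Z -> stmt-AtomisticToContinuum-17301): retired by None — LocalEquilibriumAllDim → MarginalsToFieldsAllDim → FlowRelabelSymmetry → DimThreeGlue → DiluteSelfConsistency → Literature.MathematicalPhysics.KineticTheory.HydrodynamicLimit
/-- item stmt-AtomisticToContinuum-17301 · assembly · rank 1 · open · by planner
sources: Spohn1991, OllaVaradhanYau1993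
[assembly] LocalEquilibriumAllDim → FlowRelabelSymmetry → MarginalsToFieldsAllDim →
HydrodynamicLimit (the re-typed packing-guarded conjunct, p126922): EngineToAllDim (stmt-14524)
composed with the deciding theorem closes : AllDimensionEuler → HydrodynamicLimit; pure logic once
EngineToAllDim is proved. Restated 2026-08-16 from the rev-4 form … → DimThreeGlue →
DiluteSelfConsistency → (unguarded) Literature HydrodynamicLimit, which targeted the pre-retype
abbrev. -/
@[route_item "route-AtomisticToContinuum-DimensionLadder"]
def Assembly : Prop :=
  LocalEquilibriumAllDim → FlowRelabelSymmetry → MarginalsToFieldsAllDim → _root_.HydrodynamicLimit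

/-! D-0027 §2.1 — DECIDING THEOREM (planner-authored via `route open/edit --closes-file`; by planner-rbadge-AtomisticToContinuum-DimensionL-94eb196d-g2-0 2026-08-16T23:41:58Z):
its hypotheses are this route's items and its conclusion the sub-problem Statement (glue_lint), and it elaborates with this file. -/

@[closes "route-AtomisticToContinuum-DimensionLadder"] theorem closes (hX : AllDimensionEuler) : _root_.HydrodynamicLimit :=
  hydroLimitInBandDim_three_iff_root.mp
    ((Literature.MathematicalPhysics.KineticTheory.hydroLimitInBandDim_iff 3).mpr (hX 3 le_rfl))

end Summit.AtomisticToContinuum.HydrodynamicLimit.Theses.DimensionLadder
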